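import Literature.Computability.QuantumComplexity.OneCleanQubitPurification
import HarnessLib

/-!
# `DQC1 ⊆ BQP`, II: the amplifier — purified copies, a reversible majority, and its description in `FP`

Topic `Literature/Computability/QuantumComplexity`; second file of the discharge of the named fact
`knillLaflamme1998_DQC1_subset_BQP` (`OneCleanQubit.lean`; Knill–Laflamme 1998, p. 5675; Shor–Jordan
2008, §1), after `OneCleanQubitPurification.lean` (one purified block). Given the data of a `DQC1`
decider (`DQC1Amp.Params`: register sizes `k x ≤ pd(|x|)`, oracle-free one-clean-qubit circuits `C x`
on `1 + k x` wires, a polynomial `pK`), the **amplified circuit** `DQC1Amp.circ P x` on `1 + anc |x|`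
wires (wire `0` idle: it is the input wire of the circuit-acceptance problem and receives the verdict) is

  `⨁_{j < K} (conjGates j ++ front (purify (C x)) ++ conjGates j) ++ stage3`,   `K = 2 pK(|x|) + 1`,

in the layout of `PolyCopies.lean` (front window `[0, b)`, `b = 2 pd + 2`; `K` blocks of width `b` from
`base = b + 1`; swap–copy–swap runs the purified block on block `j`, `WireConjugation.lean`; the
`Params` of `PolyCopies`/`PostBQPAmp` take a circuit *family* and cannot be instantiated by per-input
circuits, so the layout, block and conjugation lemmas are restated for this `Params` and proved line
by line as there — hence the near-duplicate statements), followed by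
a reversible **threshold network**: a grid of cells `c[t][j]` ("at least `t` of the first `j` copies
accept", `t ≤ T = pK + 1`, `j ≤ K`) filled column by column by the or-accumulating word
`TOF aⱼ c[t-1][j] d; CNOT c[t][j] c'; CNOT d c'; TOF c[t][j] d c'` (`c' = c[t][j+1]`,
`x ∨ y = x ⊕ y ⊕ xy`), and a final `CNOT` of `c[T][K]` onto wire `0` ("calculate the majority of the `k`
answers", Bennett–Bernstein–Brassard–Vazirani 1997, proof of Thm. 4.13, step 4). Proved here:

* Part II: layout, programs, well-formedness, the circuits, the conjugating swap
  (`toMatrix_conjGates_mulVec_basisState`), the product state after the quantum stage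
  (`stageQ_mulVec_zero`) and the one-block marginals (`sum_filter_blockState_true = oneCleanQubitAcceptProb`);
* Part III: the threshold stage writes `[T ≤ #accepting copies]` onto wire `0` (`clEval_prog3_apply_zero`,
  an invariant over the columns of the grid);
* Part IV: **`acceptProb_circ_ge` / `acceptProb_circ_le`** — a one-clean-qubit advantage `η` becomes
  two-sided error `≤ 1/(4 K η²)` (product law `sum_normSq_prodState_mul`, weighted Chebyshev bound
  `sum_majority_fail_mul_le` of `Complexity/MajorityVoteWeighted.lean`);
* Part V: **`desc_mem_FP`** — the record `⟨[0], ⟨bin 1, ⟨1^{anc |x|}, encode (circ x)⟩⟩⟩` is an `FP`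
  function of `x` when `x ↦ sigmaEncode ⟨1, k x, C x⟩` is (counted fold of swap–purify–code–swap pieces
  as in `PolyCopies.sqF`, generator programs for the purification layer and the grid, `GenPrograms.lean`).

The assembly with the circuit-acceptance reduction (`Lemma24SignHard.lean`) is `OneCleanQubitProofs.lean`.

## References

* E. Knill, R. Laflamme, Phys. Rev. Lett. 81 (1998) 5672–5675, pp. 5673, 5675 [KnillLaflamme1998].
* P. W. Shor, S. P. Jordan, Quantum Inf. Comput. 8 (2008) 681–714, §1 [ShorJordan2008].
* C. H. Bennett, E. Bernstein, G. Brassard, U. Vazirani, *Strengths and weaknesses of quantum computing*,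
  SIAM J. Comput. 26 (1997) 1510–1523, Thm. 4.13 and its proof [BennettBernsteinBrassardVazirani1997].
* M. A. Nielsen, I. L. Chuang, *Quantum Computation and Quantum Information*, CUP 2010, §1.3.4, §2.1.7
  eq. (2.45), §2.2.8, §2.5, §3.2.5, §4.3 [NielsenChuang2010].
* S. Arora, B. Barak, *Computational Complexity: A Modern Approach*, CUP 2009, §1.3, §6.1, §6.2 and
  Remark 6.7, §10.3.7 Lemma 10.10 [AroraBarak2009].
-/

noncomputable section

namespace Literature.Computability.QuantumComplexity

namespace DQC1Amp

open _root_.Computability Complexity Cryptography RevSim RevMux RevDesc Function Matrix Finset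

/-! ## Part II. The amplifier: layout, programs, circuits -/

/-- The data of the amplifier (a hypothesis structure): the register sizes `k x` and one-clean-qubit
circuits `C x` of a `DQC1` decider, a polynomial bound `pd` of the register size, and the polynomial
`pK` governing the number of copies `K(n) = 2 pK(n) + 1` (majority threshold `pK(n) + 1`).
[cite: BennettBernsteinBrassardVazirani1997, Thm. 4.13 (k copies, k polynomial)] -/
structure Params where
  /-- the register size of the one-clean-qubit circuit on input `x` -/
  k : List Bool → ℕ
  /-- the one-clean-qubit circuit on input `x` (clean wire `0`, register `1 … k x`) -/
  C : (x : List Bool) → QCircuit cliffordT (1 + k x)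
  /-- the circuits are oracle-free -/
  hC : ∀ x, (C x).IsOracleFree
  /-- a polynomial bound of the register size in the input length -/
  pd : Polynomial ℕ
  /-- the bound -/
  hk : ∀ x, k x ≤ pd.eval x.length
  /-- half the number of copies (rounded down), as a polynomial of the input length -/
  pK : Polynomial ℕ

variable (P : Params)

/-! ### Layout (all quantities are functions of the input length `n`) -/

/-- The register bound `p n`. [folklore] -/
def p (n : ℕ) : ℕ := P.pd.eval n

/-- The block width (= the width of the front window): `2 p n + 2 ≥ 1 + p n + p n`. [folklore] -/
def b (n : ℕ) : ℕ := 2 * p P n + 2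

/-- Half the number of copies, rounded down. [folklore] -/
def K' (n : ℕ) : ℕ := P.pK.eval n

/-- The (odd) number of copies `K n = 2 K' n + 1`. [cite: BennettBernsteinBrassardVazirani1997, Thm. 4.13] -/
def K (n : ℕ) : ℕ := 2 * K' P n + 1

/-- The majority threshold `T n = K' n + 1` (a strict majority of `K n` copies). [cite: BennettBernsteinBrassardVazirani1997, Thm. 4.13 (proof, step 4)] -/
def T (n : ℕ) : ℕ := K' P n + 1

/-- The first wire of the blocks (one idle wire after the front window). [folklore] -/
def base (n : ℕ) : ℕ := b P n + 1

/-- Wire `i` of block `j`. [folklore] -/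
def blk (n j i : ℕ) : ℕ := base P n + j * b P n + i

/-- The first wire of the threshold grid (right after the blocks). [folklore] -/
def G0 (n : ℕ) : ℕ := base P n + K P n * b P n

/-- Cell `(t, j)` of the threshold grid (`t ≤ T n`, `j ≤ K n`): "at least `t` of the first `j`
copies accept". [cite: BennettBernsteinBrassardVazirani1997, Thm. 4.13 (proof, step 4)] -/
def cpos (n t j : ℕ) : ℕ := G0 P n + t * (K P n + 1) + j

/-- The first wire of the conjunction ancillas. [folklore] -/
def D0 (n : ℕ) : ℕ := G0 P n + (T P n + 1) * (K P n + 1)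

/-- The conjunction ancilla of cell `(t, j)` (`t ≤ T n`, `j < K n`). [folklore] -/
def dpos (n t j : ℕ) : ℕ := D0 P n + t * K P n + j

/-- The total number of wires. [folklore] -/
def W (n : ℕ) : ℕ := D0 P n + (T P n + 1) * K P n + 1

/-- The number of ancillas after the (single, idle) input wire. [folklore] -/
def anc (n : ℕ) : ℕ := W P n - 1

/-! ### Size bookkeeping -/

section Sizes

variable {P}

/-- `0 < K n`. [folklore] -/
theorem K_pos (n : ℕ) : 0 < K P n := by unfold K; omega

/-- `2 ≤ b n`. [folklore] -/
theorem two_le_b (n : ℕ) : 2 ≤ b P n := by unfold b; omega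

/-- `0 < b n`. [folklore] -/
theorem b_pos (n : ℕ) : 0 < b P n := lt_of_lt_of_le Nat.zero_lt_two (two_le_b n)

/-- The purified block of input `x` fits into a block. [folklore] -/
theorem pur_fits (x : List Bool) : 1 + P.k x + P.k x ≤ b P x.length := by
  have := P.hk x; unfold b p; omega

/-- `b n < base n`. [folklore] -/
theorem b_lt_base (n : ℕ) : b P n < base P n := by unfold base; omega

/-- `blk n 0 0 = base n`. [folklore] -/
theorem blk_zero_zero (n : ℕ) : blk P n 0 0 = base P n := by unfold blk; simp

/-- `blk n j i = blk n j 0 + i`. [folklore] -/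
theorem blk_eq_add (n j i : ℕ) : blk P n j i = blk P n j 0 + i := by unfold blk; omega

/-- Wires of block `j < K n` are below `G0`. [folklore] -/
theorem blk_lt_G0 {n j i : ℕ} (hj : j < K P n) (hi : i < b P n) : blk P n j i < G0 P n := by
  unfold blk G0
  have : j * b P n + i < K P n * b P n := by
    calc j * b P n + i < j * b P n + b P n := by omega
      _ = (j + 1) * b P n := by ring
      _ ≤ K P n * b P n := Nat.mul_le_mul_right _ hj
  omega

/-- Blocks are disjoint: equal wires have equal block and offset. [folklore] -/
theorem blk_inj {n j i j' i' : ℕ} (hi : i < b P n) (hi' : i' < b P n) (h : blk P n j i = blk P n j' i') :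
    j = j' ∧ i = i' := by
  unfold blk at h
  have h1 : j * b P n + i = j' * b P n + i' := by omega
  have hj : j = j' := by nlinarith
  subst hj
  exact ⟨rfl, by omega⟩

/-- `base ≤ blk`. [folklore] -/
theorem base_le_blk (n j i : ℕ) : base P n ≤ blk P n j i := by unfold blk; omega

/-- `base ≤ G0`. [folklore] -/
theorem base_le_G0 (n : ℕ) : base P n ≤ G0 P n := by unfold G0; omega

/-- `G0 ≤ cpos`. [folklore] -/
theorem G0_le_cpos (n t j : ℕ) : G0 P n ≤ cpos P n t j := by unfold cpos; omega

/-- Cells are below `D0`. [folklore] -/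
theorem cpos_lt_D0 {n t j : ℕ} (ht : t ≤ T P n) (hj : j ≤ K P n) : cpos P n t j < D0 P n := by
  unfold cpos D0
  have : t * (K P n + 1) + j < (T P n + 1) * (K P n + 1) := by
    calc t * (K P n + 1) + j < t * (K P n + 1) + (K P n + 1) := by omega
      _ = (t + 1) * (K P n + 1) := by ring
      _ ≤ (T P n + 1) * (K P n + 1) := Nat.mul_le_mul_right _ (by omega)
  omega

/-- `D0 ≤ dpos`. [folklore] -/
theorem D0_le_dpos (n t j : ℕ) : D0 P n ≤ dpos P n t j := by unfold dpos; omega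

/-- Conjunction ancillas are below `W - 1`. [folklore] -/
theorem dpos_lt {n t j : ℕ} (ht : t ≤ T P n) (hj : j < K P n) : dpos P n t j + 1 < W P n := by
  unfold dpos W
  have : t * K P n + j < (T P n + 1) * K P n := by
    calc t * K P n + j < t * K P n + K P n := by omega
      _ = (t + 1) * K P n := by ring
      _ ≤ (T P n + 1) * K P n := Nat.mul_le_mul_right _ (by omega)
  omega

/-- `D0 < W`. [folklore] -/
theorem D0_lt_W (n : ℕ) : D0 P n < W P n := by unfold W; omega

/-- Cells are injective in `(t, j)`. [folklore] -/
theorem cpos_inj {n t j t' j' : ℕ} (hj : j ≤ K P n) (hj' : j' ≤ K P n) (h : cpos P n t j = cpos P n t' j') :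
    t = t' ∧ j = j' := by
  unfold cpos at h
  have h1 : t * (K P n + 1) + j = t' * (K P n + 1) + j' := by omega
  have ht : t = t' := by nlinarith
  subst ht
  exact ⟨rfl, by omega⟩

/-- Conjunction ancillas are injective in `(t, j)`. [folklore] -/
theorem dpos_inj {n t j t' j' : ℕ} (hj : j < K P n) (hj' : j' < K P n) (h : dpos P n t j = dpos P n t' j') :
    t = t' ∧ j = j' := by
  unfold dpos at h
  have h1 : t * K P n + j = t' * K P n + j' := by omega
  have ht : t = t' := by nlinarith
  subst ht
  exact ⟨rfl, by omega⟩

/-- A cell is not a conjunction ancilla. [folklore] -/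
theorem cpos_ne_dpos {n t j t' j' : ℕ} (ht : t ≤ T P n) (hj : j ≤ K P n) : cpos P n t j ≠ dpos P n t' j' :=
  Nat.ne_of_lt (lt_of_lt_of_le (cpos_lt_D0 ht hj) (D0_le_dpos n t' j'))

/-- A block wire is not a cell. [folklore] -/
theorem blk_ne_cpos {n j i t j' : ℕ} (hj : j < K P n) (hi : i < b P n) : blk P n j i ≠ cpos P n t j' :=
  Nat.ne_of_lt (lt_of_lt_of_le (blk_lt_G0 hj hi) (G0_le_cpos n t j'))

/-- A block wire is not a conjunction ancilla. [folklore] -/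
theorem blk_ne_dpos {n j i t j' : ℕ} (hj : j < K P n) (hi : i < b P n) : blk P n j i ≠ dpos P n t j' :=
  Nat.ne_of_lt (lt_of_lt_of_le (blk_lt_G0 hj hi) ((G0_le_cpos n 0 0).trans
    ((cpos_lt_D0 (Nat.zero_le _) (Nat.zero_le _)).le.trans (D0_le_dpos n t j'))))

/-- `1 ≤ W n`. [folklore] -/
theorem one_le_W (n : ℕ) : 1 ≤ W P n := by unfold W; omega

/-- **`1 + anc n = W n`.** [folklore] -/
theorem one_add_anc (n : ℕ) : 1 + anc P n = W P n := by have := one_le_W (P := P) n; unfold anc; omega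

/-- There is a wire. [folklore] -/
theorem width_pos (n : ℕ) : 0 < 1 + anc P n := Nat.add_pos_left Nat.one_pos _

/-- The front window fits. [folklore] -/
theorem b_fits (n : ℕ) : b P n ≤ 1 + anc P n := by
  rw [one_add_anc]
  exact (b_lt_base n).le.trans ((base_le_G0 n).trans ((G0_le_cpos n 0 0).trans
    ((cpos_lt_D0 (Nat.zero_le _) (Nat.zero_le _)).le.trans (D0_lt_W n).le)))

/-- `G0` fits. [folklore] -/
theorem G0_lt_width (n : ℕ) : G0 P n < 1 + anc P n := by
  rw [one_add_anc]
  exact lt_of_le_of_lt (G0_le_cpos n 0 0) ((cpos_lt_D0 (Nat.zero_le _) (Nat.zero_le _)).trans (D0_lt_W n))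

/-- Cells fit. [folklore] -/
theorem cpos_fits {n t j : ℕ} (ht : t ≤ T P n) (hj : j ≤ K P n) : cpos P n t j < 1 + anc P n := by
  rw [one_add_anc]; exact (cpos_lt_D0 ht hj).trans (D0_lt_W n)

/-- Conjunction ancillas fit. [folklore] -/
theorem dpos_fits {n t j : ℕ} (ht : t ≤ T P n) (hj : j < K P n) : dpos P n t j < 1 + anc P n := by
  rw [one_add_anc]; have := dpos_lt (P := P) ht hj; omega

/-- Block wires fit. [folklore] -/
theorem blk_fits {n j i : ℕ} (hj : j < K P n) (hi : i < b P n) : blk P n j i < 1 + anc P n :=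
  (blk_lt_G0 hj hi).trans (G0_lt_width n)

end Sizes

/-! ### The programs -/

/-- The pairs (front wire `i`, wire `i` of block `j`), `i < b n`. [folklore] -/
def conjPairs (n j : ℕ) : List (ℕ × ℕ) := (List.range (b P n)).map fun i => (i, blk P n j i)

/-- **The conjugating swap of block `j` with the front window.** [cite: NielsenChuang2010, §1.3.4 (swap from three CNOTs)] -/
def progConj (n j : ℕ) : List (ClOp ℕ) := swapOps (conjPairs P n j)

/-- **Row `0` of the threshold grid**: "at least `0` of the first `j` copies accept" is `true`. [cite: BennettBernsteinBrassardVazirani1997, Thm. 4.13 (proof, step 4)] -/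
def progRow0 (n : ℕ) : List (ClOp ℕ) := (List.range (K P n + 1)).map fun j => ClOp.not (cpos P n 0 j)

/-- **The cell of row `t + 1`, column `j`**: `d ← aⱼ ∧ c[t][j]`, `c[t+1][j+1] ← c[t+1][j] ∨ d`
(`x ∨ y = x ⊕ y ⊕ xy`). [cite: BennettBernsteinBrassardVazirani1997, Thm. 4.13 (proof, step 4)] -/
def cellOps (n t j : ℕ) : List (ClOp ℕ) :=
  [ClOp.toffoli (blk P n j 0) (cpos P n t j) (dpos P n (t + 1) j),
   ClOp.cnot (cpos P n (t + 1) j) (cpos P n (t + 1) (j + 1)),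
   ClOp.cnot (dpos P n (t + 1) j) (cpos P n (t + 1) (j + 1)),
   ClOp.toffoli (cpos P n (t + 1) j) (dpos P n (t + 1) j) (cpos P n (t + 1) (j + 1))]

/-- Column `j` of the grid: the cells of rows `1, …, T n`. [folklore] -/
def colOps (n j : ℕ) : List (ClOp ℕ) := (List.range (T P n)).flatMap fun t => cellOps P n t j

/-- All cells, column by column. [folklore] -/
def progCells (n : ℕ) : List (ClOp ℕ) := (List.range (K P n)).flatMap fun j => colOps P n j

/-- **Copying the verdict `c[T][K]` onto wire `0`.** [cite: BennettBernsteinBrassardVazirani1997, Thm. 4.13 (proof, step 4)] -/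
def progOut (n : ℕ) : List (ClOp ℕ) := [ClOp.cnot (cpos P n (T P n) (K P n)) 0]

/-- **The threshold stage**: row `0`, the cells, the output copy. [cite: BennettBernsteinBrassardVazirani1997, Thm. 4.13 (proof, step 4)] -/
def prog3 (n : ℕ) : List (ClOp ℕ) := progRow0 P n ++ (progCells P n ++ progOut P n)

/-! ### Well-formedness and wire bounds -/

section WF

variable {P}

/-- `progConj` is well formed. [folklore] -/
theorem progConj_wf (n j : ℕ) : ∀ op ∈ progConj P n j, op.WF := by
  refine swapOps_wf fun q hq => ?_
  simp only [conjPairs, List.mem_map, List.mem_range] at hq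
  obtain ⟨i, hi, rfl⟩ := hq
  exact Nat.ne_of_lt (lt_of_lt_of_le hi ((b_lt_base n).le.trans (base_le_blk n j i)))

/-- `progConj n j`, `j < K n`, uses wires of the register. [folklore] -/
theorem progConj_lt {n j : ℕ} (hj : j < K P n) : ∀ op ∈ progConj P n j, ∀ q ∈ wiresOf op, q < 1 + anc P n := by
  intro op hop q hq
  obtain ⟨pr, hpr, h⟩ := CWrap.wiresOf_swapOps hop q hq
  simp only [conjPairs, List.mem_map, List.mem_range] at hpr
  obtain ⟨i, hi, rfl⟩ := hpr
  rcases h with rfl | rfl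
  · exact lt_of_lt_of_le hi (b_fits n)
  · exact blk_fits hj hi

/-- Membership in `cellOps`. [folklore] -/
theorem mem_cellOps {n t j : ℕ} {op : ClOp ℕ} (hop : op ∈ cellOps P n t j) :
    op = ClOp.toffoli (blk P n j 0) (cpos P n t j) (dpos P n (t + 1) j) ∨
    op = ClOp.cnot (cpos P n (t + 1) j) (cpos P n (t + 1) (j + 1)) ∨
    op = ClOp.cnot (dpos P n (t + 1) j) (cpos P n (t + 1) (j + 1)) ∨
    op = ClOp.toffoli (cpos P n (t + 1) j) (dpos P n (t + 1) j) (cpos P n (t + 1) (j + 1)) := by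
  simpa [cellOps] using hop

/-- Membership in `progCells`. [folklore] -/
theorem mem_progCells {n : ℕ} {op : ClOp ℕ} (hop : op ∈ progCells P n) :
    ∃ j < K P n, ∃ t < T P n, op ∈ cellOps P n t j := by
  simp only [progCells, colOps, List.mem_flatMap, List.mem_range] at hop
  obtain ⟨j, hj, t, ht, h⟩ := hop
  exact ⟨j, hj, t, ht, h⟩

/-- The cells are well formed. [folklore] -/
theorem cellOps_wf {n t j : ℕ} (ht : t < T P n) (hj : j < K P n) : ∀ op ∈ cellOps P n t j, op.WF := by
  intro op hop
  have h1 : blk P n j 0 ≠ cpos P n t j := blk_ne_cpos hj (b_pos n)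
  have h2 : blk P n j 0 ≠ dpos P n (t + 1) j := blk_ne_dpos hj (b_pos n)
  have h3 : cpos P n t j ≠ dpos P n (t + 1) j := cpos_ne_dpos (by omega) hj.le
  have h4 : cpos P n (t + 1) j ≠ cpos P n (t + 1) (j + 1) := fun h => by have := (cpos_inj hj.le (by omega) h).2; omega
  have h5 : dpos P n (t + 1) j ≠ cpos P n (t + 1) (j + 1) := (cpos_ne_dpos (by omega) (by omega)).symm
  have h6 : cpos P n (t + 1) j ≠ dpos P n (t + 1) j := cpos_ne_dpos (by omega) hj.le
  rcases mem_cellOps hop with rfl | rfl | rfl | rfl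
  · exact ⟨h1, h2, h3⟩
  · exact h4
  · exact h5
  · exact ⟨h6, h4, h5⟩

/-- `prog3` is well formed. [folklore] -/
theorem prog3_wf (n : ℕ) : ∀ op ∈ prog3 P n, op.WF := by
  intro op hop
  rcases List.mem_append.1 hop with h | h
  · simp only [progRow0, List.mem_map] at h
    obtain ⟨j, -, rfl⟩ := h
    trivial
  rcases List.mem_append.1 h with h | h
  · obtain ⟨j, hj, t, ht, h⟩ := mem_progCells h
    exact cellOps_wf ht hj op h
  · simp only [progOut, List.mem_singleton] at h
    subst h
    exact Nat.ne_of_gt (lt_of_lt_of_le (lt_of_lt_of_le (b_pos n) ((b_lt_base n).le.trans (base_le_G0 n))) (G0_le_cpos n _ _))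

/-- The cells use wires of the register. [folklore] -/
theorem cellOps_lt {n t j : ℕ} (ht : t < T P n) (hj : j < K P n) : ∀ op ∈ cellOps P n t j, ∀ q ∈ wiresOf op, q < 1 + anc P n := by
  intro op hop q hq
  have h1 : blk P n j 0 < 1 + anc P n := blk_fits hj (b_pos n)
  have h2 : cpos P n t j < 1 + anc P n := cpos_fits (by omega) hj.le
  have h3 : dpos P n (t + 1) j < 1 + anc P n := dpos_fits (by omega) hj
  have h4 : cpos P n (t + 1) j < 1 + anc P n := cpos_fits (by omega) hj.le
  have h5 : cpos P n (t + 1) (j + 1) < 1 + anc P n := cpos_fits (by omega) (by omega)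
  rcases mem_cellOps hop with rfl | rfl | rfl | rfl <;>
    simp only [mem_wiresOf, ClOp.target, ClOp.controls, List.mem_cons, List.not_mem_nil, or_false] at hq
  · rcases hq with rfl | rfl | rfl <;> assumption
  · rcases hq with rfl | rfl <;> assumption
  · rcases hq with rfl | rfl <;> assumption
  · rcases hq with rfl | rfl | rfl <;> assumption

/-- `prog3` uses wires of the register. [folklore] -/
theorem prog3_lt (n : ℕ) : ∀ op ∈ prog3 P n, ∀ q ∈ wiresOf op, q < 1 + anc P n := by
  intro op hop q hq
  rcases List.mem_append.1 hop with h | h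
  · simp only [progRow0, List.mem_map, List.mem_range] at h
    obtain ⟨j, hj, rfl⟩ := h
    simp only [mem_wiresOf, ClOp.target, ClOp.controls, List.not_mem_nil, or_false] at hq
    subst hq
    exact cpos_fits (Nat.zero_le _) (by omega)
  rcases List.mem_append.1 h with h | h
  · obtain ⟨j, hj, t, ht, h⟩ := mem_progCells h
    exact cellOps_lt ht hj op h q hq
  · simp only [progOut, List.mem_singleton] at h
    subst h
    simp only [mem_wiresOf, ClOp.target, ClOp.controls, List.mem_singleton] at hq
    rcases hq with rfl | rfl
    · exact width_pos n
    · exact cpos_fits le_rfl le_rfl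

end WF

/-! ### The circuits -/

section Compile

variable {P}

variable (P) in
/-- A program over `ℕ` with wires below `1 + anc n`, re-indexed to `Fin (1 + anc n)` and turned into
reversible operations. [cite: AroraBarak2009, §10.3.7 Lemma 10.10] -/
def clamp (n : ℕ) (ops : List (ClOp ℕ)) (hlt : ∀ op ∈ ops, ∀ i ∈ wiresOf op, i < 1 + anc P n)
    (hwf : ∀ op ∈ ops, op.WF) : List (RevOp (1 + anc P n)) :=
  toRevList (ops.map (ClOp.map (finOf (1 + anc P n) (width_pos n)))) fun op hop => by
    simp only [List.mem_map] at hop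
    obtain ⟨op, hop, rfl⟩ := hop
    exact wf_map_finOf _ (hlt op hop) (hwf op hop)

/-- **Semantics of a clamped program**: the `ℕ`-program on the lifted assignment. [folklore] -/
theorem revEval_clamp (n : ℕ) (ops : List (ClOp ℕ)) (hlt : ∀ op ∈ ops, ∀ i ∈ wiresOf op, i < 1 + anc P n)
    (hwf : ∀ op ∈ ops, op.WF) (w : QReg (1 + anc P n)) (q : Fin (1 + anc P n)) :
    revEval (clamp P n ops hlt hwf) w q = clEval ops (liftW w) q := by
  unfold clamp
  rw [revEval_toRevList, clEval_map_finOf_apply _ ops hlt]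

variable (P)

/-- **The conjugating swap of block `j`**, compiled (empty for `j ≥ K n`). [cite: NielsenChuang2010, §1.3.4 (swap from three CNOTs)] -/
def conjGates (n j : ℕ) : List (QGate cliffordT (1 + anc P n)) :=
  if h : j < K P n then revCompile (clamp P n (progConj P n j) (progConj_lt h) (progConj_wf n j)) else []

/-- The front window as an embedding of `b n` wires. [folklore] -/
def frontEmb (n : ℕ) : Fin (b P n) ↪ Fin (1 + anc P n) := Fin.castLEEmb (b_fits n)

/-- **The block circuit of input `x`**: the purified one-clean-qubit circuit of `x`, on the first
`1 + k x + k x` of the `b |x|` wires of a block. [cite: NielsenChuang2010, §2.5] -/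
def Cblk (x : List Bool) : QCircuit cliffordT (b P x.length) :=
  mapWires (Fin.castLEEmb (pur_fits x)) (purify (P.C x))

/-- **The copy**: the block circuit on the front window, verbatim. [cite: AroraBarak2009, §6.2] -/
def copyGates (x : List Bool) : List (QGate cliffordT (1 + anc P x.length)) :=
  (mapWires (frontEmb P x.length) (Cblk P x)).gates

/-- **The quantum stage**: for every `j < K |x|`, swap, copy, swap back ("run `k` independent
copies"). [cite: BennettBernsteinBrassardVazirani1997, Thm. 4.13 (proof, step 3)] -/
def stageQ (x : List Bool) : List (QGate cliffordT (1 + anc P x.length)) :=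
  (List.range (K P x.length)).flatMap fun j => conjGates P x.length j ++ (copyGates P x ++ conjGates P x.length j)

/-- **The threshold stage**, compiled. [cite: BennettBernsteinBrassardVazirani1997, Thm. 4.13 (proof, step 4)] -/
def stage3 (n : ℕ) : List (QGate cliffordT (1 + anc P n)) :=
  revCompile (clamp P n (prog3 P n) (prog3_lt n) (prog3_wf n))

/-- **The amplified circuit of input `x`** on `1 + anc |x|` wires (wire `0`: the idle input wire of
the circuit-acceptance problem, which receives the verdict). [cite: BennettBernsteinBrassardVazirani1997, Thm. 4.13 (proof)] -/
def circ (x : List Bool) : QCircuit cliffordT (1 + anc P x.length) := ⟨stageQ P x ++ stage3 P x.length⟩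

variable {P}

/-- **The amplified circuit is oracle-free.** [folklore] -/
theorem circ_isOracleFree (x : List Bool) : (circ P x).IsOracleFree := by
  intro g hg
  have hg' : g ∈ stageQ P x ++ stage3 P x.length := hg
  rcases List.mem_append.1 hg' with h | h
  · obtain ⟨j, -, h⟩ := List.mem_flatMap.1 h
    have hconj : g ∈ conjGates P x.length j → g.IsOracleFree := fun h => by
      unfold conjGates at h
      split_ifs at h with hj
      · exact revCompile_isOracleFree _ g h
      · exact absurd h List.not_mem_nil
    rcases List.mem_append.1 h with h | h
    · exact hconj h
    rcases List.mem_append.1 h with h | h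
    · exact isOracleFree_mapWires _ (isOracleFree_mapWires _ (purify_isOracleFree (P.hC x))) g h
    · exact hconj h
  · exact revCompile_isOracleFree _ g h

end Compile

/-! ### The conjugating swap -/

section Conj

variable {P} {n j : ℕ} (hj : j < K P n)

/-- **The wire involution of the conjugating swap**: front wire `i < b n` ↔ wire `i` of block `j`,
all other wires fixed. [cite: NielsenChuang2010, §1.3.4 (swap from three CNOTs)] -/
def conjInvol (hj : j < K P n) (q : Fin (1 + anc P n)) : Fin (1 + anc P n) :=
  if h1 : (q : ℕ) < b P n then ⟨blk P n j q, blk_fits hj h1⟩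
  else if h2 : blk P n j 0 ≤ q ∧ (q : ℕ) < blk P n j 0 + b P n then
    ⟨q - blk P n j 0, by have := q.isLt; omega⟩
  else q

/-- `conjInvol` on a front wire. [folklore] -/
theorem conjInvol_of_lt {q : Fin (1 + anc P n)} (hq : (q : ℕ) < b P n) : (conjInvol hj q : ℕ) = blk P n j q := by
  unfold conjInvol; rw [dif_pos hq]

/-- `conjInvol` on a block wire. [folklore] -/
theorem conjInvol_blk {i : ℕ} (hi : i < b P n) : (conjInvol hj ⟨blk P n j i, blk_fits hj hi⟩ : ℕ) = i := by
  have h1 : ¬ blk P n j i < b P n := Nat.not_lt.2 ((b_lt_base n).le.trans (base_le_blk n j i))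
  have h2 : blk P n j 0 ≤ blk P n j i ∧ blk P n j i < blk P n j 0 + b P n := by rw [blk_eq_add (P := P) n j i]; omega
  unfold conjInvol
  rw [dif_neg h1, dif_pos h2]
  simp [blk_eq_add (P := P) n j i]

/-- `conjInvol` elsewhere. [folklore] -/
theorem conjInvol_of_not {q : Fin (1 + anc P n)} (hq : ¬ (q : ℕ) < b P n)
    (hq' : ¬ (blk P n j 0 ≤ q ∧ (q : ℕ) < blk P n j 0 + b P n)) : conjInvol hj q = q := by
  unfold conjInvol; rw [dif_neg hq, dif_neg hq']

/-- **`conjInvol` is an involution.** [folklore] -/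
theorem conjInvol_conjInvol (q : Fin (1 + anc P n)) : conjInvol hj (conjInvol hj q) = q := by
  have hb := (b_lt_base (P := P) n).le.trans (base_le_blk n j 0)
  by_cases h1 : (q : ℕ) < b P n
  · have e : conjInvol hj q = ⟨blk P n j q, blk_fits hj h1⟩ := by unfold conjInvol; rw [dif_pos h1]
    rw [e]
    exact Fin.ext (conjInvol_blk hj h1)
  · by_cases h2 : blk P n j 0 ≤ q ∧ (q : ℕ) < blk P n j 0 + b P n
    · have hi : (q : ℕ) - blk P n j 0 < b P n := by omega
      have e : conjInvol hj q = ⟨q - blk P n j 0, by have := q.isLt; omega⟩ := by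
        unfold conjInvol; rw [dif_neg h1, dif_pos h2]
      rw [e]
      apply Fin.ext
      rw [conjInvol_of_lt hj (by exact hi)]
      simp only
      rw [blk_eq_add (P := P) n j]; omega
    · rw [conjInvol_of_not hj h1 h2, conjInvol_of_not hj h1 h2]

/-- **The compiled conjugating swap permutes basis states along `conjInvol`.** [cite: NielsenChuang2010, §1.3.4 (swap from three CNOTs)] -/
theorem toMatrix_conjGates_mulVec_basisState (A : Language Bool) (w : QReg (1 + anc P n)) :
    (⟨conjGates P n j⟩ : QCircuit cliffordT (1 + anc P n)).toMatrix A *ᵥ basisState w = basisState (w ∘ conjInvol hj) := by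
  unfold conjGates
  rw [dif_pos hj, revCompile_mulVec_basisState]
  congr 1
  funext q
  rw [revEval_clamp]
  unfold progConj
  have hb := (b_lt_base (P := P) n).le.trans (base_le_blk n j 0)
  have h1 : ((conjPairs P n j).map Prod.fst).Nodup := by
    rw [conjPairs, List.map_map]; simpa [Function.comp_def] using List.nodup_range
  have h2 : ((conjPairs P n j).map Prod.snd).Nodup := by
    rw [conjPairs, List.map_map]
    exact List.nodup_range.map_on fun a _ c _ h => by simp only [Function.comp_apply] at h; unfold blk at h; omega
  have h12 : ∀ q ∈ conjPairs P n j, ∀ q' ∈ conjPairs P n j, q.1 ≠ q'.2 := by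
    intro q hq q' hq'
    simp only [conjPairs, List.mem_map, List.mem_range] at hq hq'
    obtain ⟨i, hi, rfl⟩ := hq; obtain ⟨i', -, rfl⟩ := hq'
    exact Nat.ne_of_lt (lt_of_lt_of_le hi ((b_lt_base n).le.trans (base_le_blk n j i')))
  obtain ⟨hsnd, hfst, hother⟩ := clEval_swapOps (conjPairs P n j) h1 h2 h12 (liftW w)
  simp only [Function.comp_apply]
  by_cases hq : (q : ℕ) < b P n
  · have hmem : ((q : ℕ), blk P n j q) ∈ conjPairs P n j := List.mem_map.2 ⟨q, List.mem_range.2 hq, rfl⟩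
    rw [hfst _ hmem]
    change liftW w (blk P n j q) = w (conjInvol hj q)
    rw [← liftW_val w (conjInvol hj q), conjInvol_of_lt hj hq]
  · by_cases hq2 : blk P n j 0 ≤ q ∧ (q : ℕ) < blk P n j 0 + b P n
    · have hi : (q : ℕ) - blk P n j 0 < b P n := by omega
      have hqe : (q : ℕ) = blk P n j (q - blk P n j 0) := by rw [blk_eq_add (P := P) n j]; omega
      have hmem : ((q : ℕ) - blk P n j 0, (q : ℕ)) ∈ conjPairs P n j :=
        List.mem_map.2 ⟨_, List.mem_range.2 hi, by rw [← hqe]⟩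
      rw [hsnd _ hmem]
      change liftW w ((q : ℕ) - blk P n j 0) = w (conjInvol hj q)
      rw [← liftW_val w (conjInvol hj q)]
      congr 1
      unfold conjInvol; rw [dif_neg hq, dif_pos hq2]
    · rw [hother _ (fun q' hq' => ?_), conjInvol_of_not hj hq hq2, liftW_val]
      simp only [conjPairs, List.mem_map, List.mem_range] at hq'
      obtain ⟨i, hi, rfl⟩ := hq'
      refine ⟨fun h => hq (h ▸ hi), fun h => hq2 ?_⟩
      rw [h, blk_eq_add (P := P) n j i]; omega

end Conj

/-! ### The blocks and the quantum stage -/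

section Blocks

variable (n : ℕ)

/-- Block `j` as an embedding of `b n` wires. [folklore] -/
def blockEmb (j : Fin (K P n)) : Fin (b P n) ↪ Fin (1 + anc P n) :=
  ⟨fun i => ⟨blk P n j i, blk_fits j.isLt i.isLt⟩, fun _ _ h => Fin.ext (blk_inj (P := P) (Fin.isLt _) (Fin.isLt _) (congrArg Fin.val h)).2⟩

variable {P n}

/-- `blockEmb` evaluated. [folklore] -/
@[simp] theorem blockEmb_apply_val (j : Fin (K P n)) (i : Fin (b P n)) : (blockEmb P n j i : ℕ) = blk P n j i := rfl

/-- **The blocks are pairwise disjoint.** [folklore] -/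
theorem blockDisjoint : BlockDisjoint (blockEmb P n) := by
  intro j j' hne
  refine Set.disjoint_left.2 ?_
  rintro w ⟨i, rfl⟩ ⟨i', hi'⟩
  have h := congrArg Fin.val hi'
  simp only [blockEmb_apply_val] at h
  exact hne (Fin.ext (blk_inj i'.isLt i.isLt h).1).symm

/-- Off the blocks means below `base` or from `G0` on. [folklore] -/
theorem offBlocks_iff (w : Fin (1 + anc P n)) : OffBlocks (blockEmb P n) w ↔ (w : ℕ) < base P n ∨ G0 P n ≤ (w : ℕ) := by
  constructor
  · intro h
    by_contra hlt
    push Not at hlt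
    have hB : 0 < b P n := b_pos n
    set d := (w : ℕ) - base P n with hd
    have hdlt : d < K P n * b P n := by unfold G0 at hlt; omega
    have hjlt : d / b P n < K P n := (Nat.div_lt_iff_lt_mul hB).2 hdlt
    have hilt : d % b P n < b P n := Nat.mod_lt _ hB
    refine h ⟨d / b P n, hjlt⟩ ⟨⟨d % b P n, hilt⟩, Fin.ext ?_⟩
    simp only [blockEmb_apply_val]
    unfold blk
    have := Nat.div_add_mod d (b P n)
    rw [Nat.mul_comm] at this
    omega
  · rintro hw j ⟨i, rfl⟩
    simp only [blockEmb_apply_val] at hw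
    rcases hw with hw | hw
    · exact absurd (base_le_blk (P := P) n j i) (Nat.not_le.2 hw)
    · exact absurd (blk_lt_G0 (P := P) j.isLt i.isLt) (Nat.not_lt.2 hw)

/-- Swap–copy–swap of block `j` is the block circuit embedded on block `j`, matrix-wise. [cite: NielsenChuang2010, §4.3] -/
theorem toMatrix_conjBlock_eq (A : Language Bool) (x : List Bool) (j : Fin (K P x.length)) :
    (⟨conjGates P x.length j ++ (copyGates P x ++ conjGates P x.length j)⟩ : QCircuit cliffordT (1 + anc P x.length)).toMatrix A =
      (mapWires (blockEmb P x.length j) (Cblk P x)).toMatrix A := by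
  unfold copyGates
  rw [toMatrix_conj_mapWires A (conjInvol j.isLt) (conjInvol_conjInvol j.isLt) (conjGates P x.length j)
    (toMatrix_conjGates_mulVec_basisState j.isLt A) (frontEmb P x.length) (Cblk P x), toMatrix_mapWires, toMatrix_mapWires]
  congr 1
  ext i
  simp only [Function.Embedding.trans_apply, frontEmb, Fin.castLEEmb_apply, blockEmb_apply_val, invEmb_apply]
  exact conjInvol_of_lt j.isLt (by exact i.isLt)

/-- **The quantum stage is the product of the block circuits on the blocks, matrix-wise.** [cite: NielsenChuang2010, §4.3] -/
theorem toMatrix_stageQ (A : Language Bool) (x : List Bool) :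
    (⟨stageQ P x⟩ : QCircuit cliffordT (1 + anc P x.length)).toMatrix A =
      (⟨(List.finRange (K P x.length)).flatMap fun j => (mapWires (blockEmb P x.length j) (Cblk P x)).gates⟩ :
        QCircuit cliffordT (1 + anc P x.length)).toMatrix A := by
  have hl : stageQ P x = (List.finRange (K P x.length)).flatMap fun j : Fin _ =>
      conjGates P x.length j ++ (copyGates P x ++ conjGates P x.length j) := by
    rw [stageQ, ← List.map_coe_finRange_eq_range, List.flatMap_map]
  rw [hl]
  exact toMatrix_flatMap_congr A _ _ _ fun j _ => toMatrix_conjBlock_eq A x j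

variable (P) (x : List Bool)

/-- **The block state**: the block circuit of `x` on `|0…0⟩` (the same for every block). [folklore] -/
def blockState : QReg (b P x.length) → ℂ := (Cblk P x).toMatrix 0 *ᵥ basisState (fun _ => false)

variable {P x}

/-- The all-zero input of the register: `|0⟩` on the idle input wire padded with zeros. [folklore] -/
theorem padInput_false (m : ℕ) : padInput (fun _ : Fin 1 => false) m = fun _ => false := by
  funext w
  refine Fin.addCases (fun i => ?_) (fun i => ?_) w
  · rw [padInput, Fin.append_left]
  · rw [padInput, Fin.append_right]

/-- **The state after the quantum stage on `|0…0⟩` is the product of the block states.** [cite: NielsenChuang2010, §2.1.7 eq. (2.45)] -/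
theorem stageQ_mulVec_zero :
    (⟨stageQ P x⟩ : QCircuit cliffordT (1 + anc P x.length)).toMatrix 0 *ᵥ basisState (fun _ => false) =
      prodState (blockEmb P x.length) (fun _ => blockState P x) (fun _ => false) := by
  rw [toMatrix_stageQ, basisState_eq_prodState (blockEmb P x.length) (fun _ => false),
    toMatrix_flatMap_mapWires_mulVec_prodState 0 blockDisjoint]
  rfl

/-- **Every block state is a unit vector.** [cite: NielsenChuang2010, §2.2.5] -/
theorem sum_normSq_blockState : ∑ v, ‖blockState P x v‖ ^ 2 = 1 := by
  have h := normSq_mulVec_of_mem_unitaryGroup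
    (QCircuit.toMatrix_mem_unitaryGroup_holds cliffordT_isUnitary_holds 0 (Cblk P x)) (basisState fun _ => false)
  rw [normSq_basisState] at h
  exact h

/-- **The one-block marginal of "the answer wire reads `1`" is the one-clean-qubit acceptance
probability.** [cite: ShorJordan2008, §1 p. 3] [cite: NielsenChuang2010, §2.5] -/
theorem sum_filter_blockState_true :
    (∑ v ∈ univ.filter (fun v : QReg (b P x.length) => v ⟨0, b_pos x.length⟩ = true), ‖blockState P x v‖ ^ 2) =
      oneCleanQubitAcceptProb (P.C x) := by
  classical
  rw [Finset.sum_filter, ← sum_accept_purify (P.C x)]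
  have hT : ∀ v : QReg (b P x.length), (v ⟨0, b_pos x.length⟩ = true) ↔
      ((v ∘ Fin.castLEEmb (pur_fits (P := P) x)) (cleanW (P.k x)) = true) := fun v => Iff.rfl
  simp only [blockState, Cblk, toMatrix_mapWires]
  rw [show (∑ v : QReg (b P x.length), if v ⟨0, b_pos x.length⟩ = true then
      ‖(placeGate (Fin.castLEEmb (pur_fits (P := P) x)) ((purify (P.C x)).toMatrix 0) *ᵥ basisState fun _ => false) v‖ ^ 2 else 0) =
        ∑ v : QReg (b P x.length), if ((v ∘ Fin.castLEEmb (pur_fits (P := P) x)) (cleanW (P.k x)) = true) then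
      ‖(placeGate (Fin.castLEEmb (pur_fits (P := P) x)) ((purify (P.C x)).toMatrix 0) *ᵥ basisState fun _ => false) v‖ ^ 2 else 0
    from Finset.sum_congr rfl fun v _ => by simp only [hT]]
  rw [sum_normSq_placeGate_castLE (pur_fits (P := P) x) ((purify (P.C x)).toMatrix 0) (fun _ => false)
    (fun u : QReg (1 + P.k x + P.k x) => u (cleanW (P.k x)) = true)]
  refine Finset.sum_congr rfl fun u _ => ?_
  simp only [mulVec_basisState]
  rfl

/-- The one-block marginal of "the answer wire reads `0`". [folklore] -/
theorem sum_filter_blockState_false :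
    (∑ v ∈ univ.filter (fun v : QReg (b P x.length) => v ⟨0, b_pos x.length⟩ = false), ‖blockState P x v‖ ^ 2) =
      1 - oneCleanQubitAcceptProb (P.C x) := by
  classical
  rw [← sum_filter_blockState_true (P := P) (x := x), ← sum_normSq_blockState (P := P) (x := x), eq_sub_iff_add_eq,
    ← Finset.sum_filter_add_sum_filter_not univ (fun v : QReg (b P x.length) => v ⟨0, b_pos x.length⟩ = false)]
  congr 1
  exact Finset.sum_congr (Finset.filter_congr fun v _ => by simp) fun _ _ => rfl

end Blocks

/-! ## Part III. The threshold stage computes the majority verdict -/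

section Threshold

/-- The number of accepting copies among the first `j` (read off an assignment of the wires). [folklore] -/
def cnt (n : ℕ) (w : ℕ → Bool) (j : ℕ) : ℕ := ((Finset.range j).filter fun i => w (blk P n i 0) = true).card

/-- The content the cell `(t, j)` should hold: "at least `t` of the first `j` copies accept".
[cite: BennettBernsteinBrassardVazirani1997, Thm. 4.13 (proof, step 4)] -/
def cval (n : ℕ) (w : ℕ → Bool) (t j : ℕ) : Bool := decide (t ≤ cnt P n w j)

/-- The invariant "columns `≤ j` of the table are computed" of an assignment `st` reached from the
initial assignment `w`. [folklore] -/
structure Inv (n : ℕ) (w st : ℕ → Bool) (j : ℕ) : Prop where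
  /-- the blocks and the front window are untouched -/
  hA : ∀ q < G0 P n, st q = w q
  /-- row `0` holds `true` -/
  hB : ∀ j' ≤ K P n, st (cpos P n 0 j') = true
  /-- the computed cells hold the table -/
  hC : ∀ t, 1 ≤ t → t ≤ T P n → ∀ j' ≤ j, st (cpos P n t j') = cval P n w t j'
  /-- the other cells are clear -/
  hD : ∀ t, 1 ≤ t → t ≤ T P n → ∀ j', j < j' → j' ≤ K P n → st (cpos P n t j') = false
  /-- the unused conjunction ancillas are clear -/
  hE : ∀ t, 1 ≤ t → t ≤ T P n → ∀ j', j ≤ j' → j' < K P n → st (dpos P n t j') = false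

/-- The invariant "columns `≤ j` and rows `≤ m` of column `j + 1` are computed". [folklore] -/
structure InvCol (n : ℕ) (w st : ℕ → Bool) (j m : ℕ) : Prop where
  /-- the blocks and the front window are untouched -/
  hA : ∀ q < G0 P n, st q = w q
  /-- row `0` holds `true` -/
  hB : ∀ j' ≤ K P n, st (cpos P n 0 j') = true
  /-- the old columns hold the table -/
  hC : ∀ t, 1 ≤ t → t ≤ T P n → ∀ j' ≤ j, st (cpos P n t j') = cval P n w t j'
  /-- the new column holds the table up to row `m` -/
  hC' : ∀ t, 1 ≤ t → t ≤ m → st (cpos P n t (j + 1)) = cval P n w t (j + 1)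
  /-- the later columns are clear -/
  hD : ∀ t, 1 ≤ t → t ≤ T P n → ∀ j', j + 1 < j' → j' ≤ K P n → st (cpos P n t j') = false
  /-- the new column is clear below row `m` -/
  hD' : ∀ t, m < t → t ≤ T P n → st (cpos P n t (j + 1)) = false
  /-- the conjunction ancillas of later columns are clear -/
  hE : ∀ t, 1 ≤ t → t ≤ T P n → ∀ j', j < j' → j' < K P n → st (dpos P n t j') = false
  /-- the conjunction ancillas of this column are clear below row `m` -/
  hE' : ∀ t, m < t → t ≤ T P n → st (dpos P n t j) = false

variable {P} {n : ℕ}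

/-- `cnt` at `j + 1`. [folklore] -/
theorem cnt_succ (w : ℕ → Bool) (j : ℕ) :
    cnt P n w (j + 1) = cnt P n w j + (if w (blk P n j 0) = true then 1 else 0) := by
  unfold cnt
  rw [Finset.range_add_one, Finset.filter_insert]
  split_ifs with h
  · rw [Finset.card_insert_of_notMem (fun h' => Finset.notMem_range_self (Finset.mem_filter.1 h').1)]
  · rw [Nat.add_zero]

/-- Row `0` is `true`. [folklore] -/
theorem cval_zero_row (w : ℕ → Bool) (j : ℕ) : cval P n w 0 j = true := by simp [cval]

/-- Column `0` is `false` below row `0`. [folklore] -/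
theorem cval_col_zero (w : ℕ → Bool) {t : ℕ} (ht : 1 ≤ t) : cval P n w t 0 = false := by
  simp [cval, cnt]; omega

/-- **The recursion of the threshold table**: `c[t][j+1] = c[t][j] ∨ (aⱼ ∧ c[t-1][j])`.
[cite: BennettBernsteinBrassardVazirani1997, Thm. 4.13 (proof, step 4)] -/
theorem cval_succ (w : ℕ → Bool) {t : ℕ} (ht : 1 ≤ t) (j : ℕ) :
    cval P n w t (j + 1) = (cval P n w t j || (w (blk P n j 0) && cval P n w (t - 1) j)) := by
  unfold cval
  rw [cnt_succ]
  cases w (blk P n j 0)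
  · simp
  · simp only [if_true, Bool.true_and]
    rw [Bool.eq_iff_iff]
    simp only [decide_eq_true_eq, Bool.or_eq_true]
    omega

/-- **The or-accumulating cell, abstractly**: on wires `a, c'` (read), `d` (conjunction ancilla,
clear), `l` (read) and `m` (target, clear), the word `TOF a c' d; CNOT l m; CNOT d m; TOF l d m` writes
`a ∧ c'` into `d` and `l ∨ (a ∧ c')` into `m` (`x ∨ y = x ⊕ y ⊕ xy`), and changes nothing else.
[cite: NielsenChuang2010, §3.2.5 (reversible classical computation)] -/
theorem orCell (st : ℕ → Bool) {a c' d l m : ℕ} (hdm : d ≠ m) (hld : l ≠ d) (hlm : l ≠ m)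
    (hd : st d = false) (hm : st m = false) :
    clEval [ClOp.toffoli a c' d, ClOp.cnot l m, ClOp.cnot d m, ClOp.toffoli l d m] st d = (st a && st c') ∧
    clEval [ClOp.toffoli a c' d, ClOp.cnot l m, ClOp.cnot d m, ClOp.toffoli l d m] st m = (st l || (st a && st c')) ∧
    ∀ q, q ≠ d → q ≠ m → clEval [ClOp.toffoli a c' d, ClOp.cnot l m, ClOp.cnot d m, ClOp.toffoli l d m] st q = st q := by
  simp only [clEval_cons, clEval_nil]
  set s1 := (ClOp.toffoli a c' d).eval st with hs1
  set s2 := (ClOp.cnot l m).eval s1 with hs2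
  set s3 := (ClOp.cnot d m).eval s2 with hs3
  set s4 := (ClOp.toffoli l d m).eval s3 with hs4
  have f1d : s1 d = (st a && st c') := by rw [hs1, ClOp.eval_toffoli, update_self, hd, Bool.false_xor]
  have f1 : ∀ q, q ≠ d → s1 q = st q := fun q hq => by rw [hs1, ClOp.eval_toffoli, update_of_ne hq]
  have f2m : s2 m = st l := by rw [hs2, ClOp.eval_cnot, update_self, f1 m hdm.symm, f1 l hld, hm, Bool.false_xor]
  have f2 : ∀ q, q ≠ m → s2 q = s1 q := fun q hq => by rw [hs2, ClOp.eval_cnot, update_of_ne hq]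
  have f3m : s3 m = (st l ^^ (st a && st c')) := by rw [hs3, ClOp.eval_cnot, update_self, f2m, f2 d hdm, f1d]
  have f3 : ∀ q, q ≠ m → s3 q = s2 q := fun q hq => by rw [hs3, ClOp.eval_cnot, update_of_ne hq]
  have f4m : s4 m = ((st l ^^ (st a && st c')) ^^ (st l && (st a && st c'))) := by
    rw [hs4, ClOp.eval_toffoli, update_self, f3m, f3 l hlm, f2 l hlm, f1 l hld, f3 d hdm, f2 d hdm, f1d]
  have f4 : ∀ q, q ≠ m → s4 q = s3 q := fun q hq => by rw [hs4, ClOp.eval_toffoli, update_of_ne hq]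
  refine ⟨by rw [f4 d hdm, f3 d hdm, f2 d hdm, f1d], ?_, fun q hqd hqm => by rw [f4 q hqm, f3 q hqm, f2 q hqm, f1 q hqd]⟩
  rw [f4m]
  cases st l <;> cases (st a && st c') <;> rfl

/-- **One cell**: on an assignment whose two target wires are clear, the cell writes
`aⱼ ∧ c[t][j]` into its conjunction ancilla and `c[t+1][j] ∨ (aⱼ ∧ c[t][j])` into `c[t+1][j+1]`,
and changes nothing else. [cite: NielsenChuang2010, §3.2.5 (reversible classical computation)] -/
theorem clEval_cellOps {t j : ℕ} (ht : t < T P n) (hj : j < K P n) (st : ℕ → Bool)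
    (hd : st (dpos P n (t + 1) j) = false) (hc : st (cpos P n (t + 1) (j + 1)) = false) :
    clEval (cellOps P n t j) st (dpos P n (t + 1) j) = (st (blk P n j 0) && st (cpos P n t j)) ∧
    clEval (cellOps P n t j) st (cpos P n (t + 1) (j + 1)) =
      (st (cpos P n (t + 1) j) || (st (blk P n j 0) && st (cpos P n t j))) ∧
    ∀ q, q ≠ dpos P n (t + 1) j → q ≠ cpos P n (t + 1) (j + 1) → clEval (cellOps P n t j) st q = st q := by
  have h4 : cpos P n (t + 1) j ≠ cpos P n (t + 1) (j + 1) := fun h => by have := (cpos_inj hj.le (by omega) h).2; omega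
  have h5 : dpos P n (t + 1) j ≠ cpos P n (t + 1) (j + 1) := (cpos_ne_dpos (by omega) (by omega)).symm
  have h6 : cpos P n (t + 1) j ≠ dpos P n (t + 1) j := cpos_ne_dpos (by omega) hj.le
  exact orCell st h5 h6 h4 hd hc

/-- The row-`0` negations as negations on a list of wires. [folklore] -/
theorem progRow0_eq (n : ℕ) : progRow0 P n = ((List.range (K P n + 1)).map (cpos P n 0)).map ClOp.not := by
  rw [progRow0, List.map_map]; rfl

/-- The row-`0` wires are pairwise distinct. [folklore] -/
theorem nodup_row0 (n : ℕ) : ((List.range (K P n + 1)).map (cpos P n 0)).Nodup :=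
  List.nodup_range.map_on fun _ ha _ hc h =>
    (cpos_inj (P := P) (Nat.lt_succ_iff.1 (List.mem_range.1 ha)) (Nat.lt_succ_iff.1 (List.mem_range.1 hc)) h).2

/-- Membership in the row-`0` wires. [folklore] -/
theorem mem_row0_iff {q : ℕ} : q ∈ (List.range (K P n + 1)).map (cpos P n 0) ↔ ∃ j' ≤ K P n, cpos P n 0 j' = q := by
  simp only [List.mem_map, List.mem_range]
  constructor
  · rintro ⟨j', hj', rfl⟩; exact ⟨j', by omega, rfl⟩
  · rintro ⟨j', hj', rfl⟩; exact ⟨j', by omega, rfl⟩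

/-- **After row `0`** the invariant holds with no column computed (on an initial assignment that is
clear from `G0` on). [folklore] -/
theorem inv_zero (w : ℕ → Bool) (hw : ∀ q, G0 P n ≤ q → w q = false) : Inv P n w (clEval (progRow0 P n) w) 0 := by
  rw [progRow0_eq]
  have hnot : ∀ q, (¬ ∃ j' ≤ K P n, cpos P n 0 j' = q) → clEval (((List.range (K P n + 1)).map (cpos P n 0)).map ClOp.not) w q = w q :=
    fun q hq => clEval_map_not_of_not_mem _ _ (fun h => hq (mem_row0_iff.1 h))
  refine ⟨fun q hq => hnot q ?_, fun j' hj' => ?_, fun t ht htT j' hj' => ?_, fun t ht htT j' _ hj'K => ?_,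
    fun t ht htT j' _ hj'K => ?_⟩
  · rintro ⟨j', -, rfl⟩
    exact absurd (G0_le_cpos (P := P) n 0 j') (Nat.not_le.2 hq)
  · rw [clEval_map_not_of_mem _ (nodup_row0 n) _ (mem_row0_iff.2 ⟨j', hj', rfl⟩), hw _ (G0_le_cpos n 0 j')]
    rfl
  · obtain rfl : j' = 0 := Nat.le_zero.1 hj'
    rw [cval_col_zero _ ht, hnot _ (fun ⟨j'', hj'', h⟩ => by have := (cpos_inj hj'' (Nat.zero_le _) h).1; omega),
      hw _ (G0_le_cpos n t 0)]
  · rw [hnot _ (fun ⟨j'', hj'', h⟩ => by have := (cpos_inj hj'' hj'K h).1; omega), hw _ (G0_le_cpos n t j')]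
  · rw [hnot _ (fun ⟨j'', hj'', h⟩ => cpos_ne_dpos (Nat.zero_le _) hj'' h),
      hw _ (((G0_le_cpos n 0 0).trans (cpos_lt_D0 (Nat.zero_le _) (Nat.zero_le _)).le).trans (D0_le_dpos n t j'))]

/-- Starting a column. [folklore] -/
theorem invCol_of_inv {w st : ℕ → Bool} {j : ℕ} (hj : j < K P n) (h : Inv P n w st j) : InvCol P n w st j 0 :=
  ⟨h.hA, h.hB, h.hC, fun t ht ht0 => by omega, fun t ht htT j' hj' hj'K => h.hD t ht htT j' (by omega) hj'K,
    fun t ht htT => h.hD t (by omega) htT (j + 1) (Nat.lt_succ_self j) (by omega),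
    fun t ht htT j' hj' hj'K => h.hE t ht htT j' hj'.le hj'K, fun t ht htT => h.hE t (by omega) htT j le_rfl hj⟩

/-- **One cell preserves the column invariant and advances it by one row.** [cite: BennettBernsteinBrassardVazirani1997, Thm. 4.13 (proof, step 4)] -/
theorem invCol_step {w st : ℕ → Bool} {j m : ℕ} (hj : j < K P n) (hm : m < T P n) (h : InvCol P n w st j m) :
    InvCol P n w (clEval (cellOps P n m j) st) j (m + 1) := by
  obtain ⟨hdv, hcn, hrest⟩ := clEval_cellOps hm hj st (h.hE' (m + 1) (Nat.lt_succ_self m) hm) (h.hD' (m + 1) (Nat.lt_succ_self m) hm)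
  -- the values read by the cell
  have hA0 : st (blk P n j 0) = w (blk P n j 0) := h.hA _ (blk_lt_G0 hj (b_pos n))
  have hCp : st (cpos P n m j) = cval P n w m j := by
    rcases Nat.eq_zero_or_pos m with rfl | hm1
    · rw [h.hB j hj.le, cval_zero_row]
    · exact h.hC m hm1 hm.le j le_rfl
  have hCl : st (cpos P n (m + 1) j) = cval P n w (m + 1) j := h.hC (m + 1) (by omega) hm j le_rfl
  have hnew : clEval (cellOps P n m j) st (cpos P n (m + 1) (j + 1)) = cval P n w (m + 1) (j + 1) := by
    rw [hcn, hCl, hA0, hCp, cval_succ _ (by omega)]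
    rfl
  -- wires other than the two targets are unchanged
  have hne_c : ∀ t j', t ≤ T P n → j' ≤ K P n → (t ≠ m + 1 ∨ j' ≠ j + 1) →
      clEval (cellOps P n m j) st (cpos P n t j') = st (cpos P n t j') := fun t j' ht hj' hne =>
    hrest _ (cpos_ne_dpos ht hj') fun e => by
      obtain ⟨e1, e2⟩ := cpos_inj hj' (by omega) e
      exact hne.elim (fun h => h e1) (fun h => h e2)
  have hne_d : ∀ t j', j' < K P n → (t ≠ m + 1 ∨ j' ≠ j) →
      clEval (cellOps P n m j) st (dpos P n t j') = st (dpos P n t j') := fun t j' hj' hne =>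
    hrest _ (fun e => by
      obtain ⟨e1, e2⟩ := dpos_inj hj' hj e
      exact hne.elim (fun h => h e1) (fun h => h e2)) (cpos_ne_dpos (by omega) (by omega)).symm
  refine ⟨fun q hq => ?_, fun j' hj' => ?_, fun t ht htT j' hj' => ?_, fun t ht htm => ?_, fun t ht htT j' hj' hj'K => ?_,
    fun t ht htT => ?_, fun t ht htT j' hj' hj'K => ?_, fun t ht htT => ?_⟩
  · rw [hrest q (Nat.ne_of_lt (lt_of_lt_of_le hq (((G0_le_cpos n 0 0).trans (cpos_lt_D0 (Nat.zero_le _) (Nat.zero_le _)).le).trans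
      (D0_le_dpos n _ _)))) (Nat.ne_of_lt (lt_of_lt_of_le hq (G0_le_cpos n _ _))), h.hA q hq]
  · rw [hne_c 0 j' (Nat.zero_le _) hj' (Or.inl (by omega)), h.hB j' hj']
  · rw [hne_c t j' htT (by omega) (Or.inr (by omega)), h.hC t ht htT j' hj']
  · rcases Nat.lt_or_ge t (m + 1) with htl | htl
    · rw [hne_c t (j + 1) (by omega) (by omega) (Or.inl (by omega)), h.hC' t ht (by omega)]
    · obtain rfl : t = m + 1 := le_antisymm htm htl
      exact hnew
  · rw [hne_c t j' htT hj'K (Or.inr (by omega)), h.hD t ht htT j' hj' hj'K]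
  · rw [hne_c t (j + 1) htT (by omega) (Or.inl (by omega)), h.hD' t (by omega) htT]
  · rw [hne_d t j' hj'K (Or.inr (by omega)), h.hE t ht htT j' hj' hj'K]
  · rw [hne_d t j hj (Or.inl (by omega)), h.hE' t (by omega) htT]

/-- **A whole column.** [folklore] -/
theorem invCol_col {w st : ℕ → Bool} {j : ℕ} (hj : j < K P n) (h : InvCol P n w st j 0) :
    ∀ m ≤ T P n, InvCol P n w (clEval ((List.range m).flatMap fun t => cellOps P n t j) st) j m
  | 0, _ => by simpa using h
  | m + 1, hm => by
    rw [List.range_succ, List.flatMap_append, clEval_append, List.flatMap_singleton]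
    exact invCol_step hj (by omega) (invCol_col hj h m (by omega))

/-- Finishing a column. [folklore] -/
theorem inv_succ {w st : ℕ → Bool} {j : ℕ} (h : InvCol P n w st j (T P n)) : Inv P n w st (j + 1) :=
  ⟨h.hA, h.hB, fun t ht htT j' hj' => by
    rcases Nat.lt_or_ge j' (j + 1) with hl | hl
    · exact h.hC t ht htT j' (by omega)
    · obtain rfl : j' = j + 1 := le_antisymm hj' hl
      exact h.hC' t ht htT,
   fun t ht htT j' hj' hj'K => h.hD t ht htT j' hj' hj'K, fun t ht htT j' hj' hj'K => h.hE t ht htT j' (by omega) hj'K⟩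

/-- **All columns.** [folklore] -/
theorem inv_cells {w st : ℕ → Bool} (h : Inv P n w st 0) :
    ∀ j ≤ K P n, Inv P n w (clEval ((List.range j).flatMap fun j' => colOps P n j') st) j
  | 0, _ => by simpa using h
  | j + 1, hj => by
    rw [List.range_succ, List.flatMap_append, clEval_append, List.flatMap_singleton]
    have ih := inv_cells h j (by omega)
    exact inv_succ (invCol_col (by omega) (invCol_of_inv (by omega) ih) (T P n) le_rfl)

/-- **The threshold stage writes the majority verdict onto wire `0`**: on an assignment clear on wire
`0` and from `G0` on, after `prog3` wire `0` holds `[T ≤ #accepting copies]`.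
[cite: BennettBernsteinBrassardVazirani1997, Thm. 4.13 (proof, step 4)] -/
theorem clEval_prog3_apply_zero (w : ℕ → Bool) (hw : ∀ q, G0 P n ≤ q → w q = false) (hw0 : w 0 = false) :
    clEval (prog3 P n) w 0 = cval P n w (T P n) (K P n) := by
  have hInv : Inv P n w (clEval (progCells P n) (clEval (progRow0 P n) w)) (K P n) :=
    inv_cells (inv_zero w hw) (K P n) le_rfl
  have hG0 : 0 < G0 P n := lt_of_lt_of_le (lt_of_lt_of_le (b_pos n) ((b_lt_base n).le)) (base_le_G0 n)
  rw [prog3, clEval_append, clEval_append, progOut, clEval_cons, clEval_nil, ClOp.eval_cnot, update_self,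
    hInv.hA 0 hG0, hInv.hC (T P n) (by unfold T; omega) le_rfl (K P n) le_rfl, hw0, Bool.false_xor]

end Threshold

/-! ## Part IV. The acceptance probability of the amplified circuit -/

section Law

variable (n : ℕ)

/-- **The threshold stage as an injective self-map of the basis labels.** [cite: NielsenChuang2010, §3.2.5] -/
def perm3 : QReg (1 + anc P n) ↪ QReg (1 + anc P n) :=
  ⟨revEval (clamp P n (prog3 P n) (prog3_lt n) (prog3_wf n)), by
    unfold clamp
    intro a c h
    rw [revEval_toRevList, revEval_toRevList] at h
    exact clEval_injective _ (fun op hop => by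
      simp only [List.mem_map] at hop
      obtain ⟨op, hop, rfl⟩ := hop
      exact wf_map_finOf _ (prog3_lt n op hop) (prog3_wf n op hop)) h⟩

variable {P n}

/-- `perm3` evaluated: the `ℕ`-program on the lifted assignment. [folklore] -/
theorem perm3_apply (z : QReg (1 + anc P n)) (q : Fin (1 + anc P n)) : perm3 P n z q = clEval (prog3 P n) (liftW z) q :=
  revEval_clamp n _ _ _ z q

/-- **The threshold stage permutes basis states along `perm3`.** [cite: AroraBarak2009, §10.3.7 Lemma 10.10] -/
theorem toMatrix_stage3_mulVec_basisState (A : Language Bool) (z : QReg (1 + anc P n)) :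
    (⟨stage3 P n⟩ : QCircuit cliffordT (1 + anc P n)).toMatrix A *ᵥ basisState z = basisState (perm3 P n z) := by
  rw [stage3, revCompile_mulVec_basisState]
  rfl

/-- The answer wire of copy `j`. [folklore] -/
def ansW (n : ℕ) (j : Fin (K P n)) : Fin (1 + anc P n) := blockEmb P n j ⟨0, b_pos n⟩

/-- Counting over `Fin M` is counting over `range M`. [folklore] -/
theorem card_filter_fin' (M : ℕ) (Q : ℕ → Prop) [DecidablePred Q] :
    (univ.filter fun c : Fin M => Q c).card = ((Finset.range M).filter Q).card := by
  rw [← Finset.card_map Fin.valEmbedding]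
  congr 1
  ext m
  simp only [Finset.mem_map, Finset.mem_filter, Finset.mem_univ, true_and, Fin.valEmbedding_apply, Finset.mem_range]
  constructor
  · rintro ⟨c, hc, rfl⟩; exact ⟨c.isLt, hc⟩
  · rintro ⟨hm, hQ⟩; exact ⟨⟨m, hm⟩, hQ, rfl⟩

/-- **On the labels supported by the product state, the threshold stage writes the majority verdict
onto wire `0`.** [cite: BennettBernsteinBrassardVazirani1997, Thm. 4.13 (proof, step 4)] -/
theorem perm3_apply_zero (z : QReg (1 + anc P n)) (hz : ∀ w, OffBlocks (blockEmb P n) w → z w = false) :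
    perm3 P n z ⟨0, width_pos n⟩ = decide (T P n ≤ (univ.filter fun j : Fin (K P n) => z (ansW n j) = true).card) := by
  have hw : ∀ q, G0 P n ≤ q → liftW z q = false := by
    intro q hq
    by_cases hlt : q < 1 + anc P n
    · simpa [liftW, hlt] using hz ⟨q, hlt⟩ ((offBlocks_iff _).2 (Or.inr hq))
    · simp [liftW, hlt]
  have hw0 : liftW z 0 = false := by
    simpa [liftW, width_pos n] using hz ⟨0, width_pos n⟩ ((offBlocks_iff _).2 (Or.inl (lt_of_lt_of_le (b_pos n) (b_lt_base n).le)))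
  have e := card_filter_fin' (K P n) (fun i => liftW z (blk P n i 0) = true)
  have ec : (univ.filter fun c : Fin (K P n) => liftW z (blk P n c 0) = true).card =
      (univ.filter fun j => z (ansW n j) = true).card :=
    congrArg Finset.card (Finset.filter_congr fun j _ => by rw [← liftW_val z (ansW n j)]; rfl)
  rw [perm3_apply, show ((⟨0, width_pos n⟩ : Fin (1 + anc P n)) : ℕ) = 0 from rfl, clEval_prog3_apply_zero _ hw hw0, cval, cnt,
    ← e, ec]

/-- **The final state**: the threshold stage applied to the product state. [folklore] -/
theorem runOn_circ (x : List Bool) :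
    (circ P x).runOn 0 (basisState (padInput (fun _ : Fin 1 => false) (anc P x.length))) =
      (⟨stage3 P x.length⟩ : QCircuit cliffordT (1 + anc P x.length)).toMatrix 0 *ᵥ
        prodState (blockEmb P x.length) (fun _ => blockState P x) (fun _ => false) := by
  rw [QCircuit.runOn, circ, show (⟨stageQ P x ++ stage3 P x.length⟩ : QCircuit cliffordT (1 + anc P x.length)) =
      (⟨stageQ P x⟩ : QCircuit cliffordT _).append ⟨stage3 P x.length⟩ from rfl, QCircuit.toMatrix_append,
    ← Matrix.mulVec_mulVec, padInput_false, stageQ_mulVec_zero]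

/-- **The acceptance probability of the amplified circuit as a Born sum of the product state, pulled
back along the threshold stage.** [cite: NielsenChuang2010, §2.2.5 (Born rule), §3.2.5] -/
theorem acceptProb_circ_eq (x : List Bool) :
    (circ P x).acceptProb 0 (fun _ : Fin 1 => false) = ∑ z : QReg (1 + anc P x.length),
      if perm3 P x.length z ⟨0, width_pos x.length⟩ = true then
        ‖prodState (blockEmb P x.length) (fun _ => blockState P x) (fun _ => false) z‖ ^ 2 else 0 := by
  classical
  unfold QCircuit.acceptProb
  simp only [width_pos, dif_pos]
  rw [runOn_circ, sum_ite_normSq_mulVec_of_perm (perm3 P x.length) (toMatrix_stage3_mulVec_basisState 0) _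
    (fun y : QReg (1 + anc P x.length) => y ⟨0, width_pos x.length⟩ = true)]

/-- The number of copies answering `true` and the number answering `false` add up to `K`. [folklore] -/
theorem card_true_add_card_false (s : Fin (K P n) → Bool) :
    (univ.filter fun j => s j = true).card + (univ.filter fun j => s j = false).card = K P n := by
  have h := Finset.card_filter_add_card_filter_not (s := (univ : Finset (Fin (K P n)))) (fun j => s j = true)
  simp only [Finset.card_univ, Fintype.card_fin] at h
  have e : (univ.filter fun j : Fin (K P n) => ¬ s j = true) = univ.filter fun j => s j = false :=
    Finset.filter_congr fun j _ => by simp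
  rw [e] at h
  exact h

/-- **Yes-instances: a clean-qubit advantage `η` is amplified to error `≤ 1/(4 K η²)`.** If the
one-clean-qubit acceptance probability of `C x` is at least `1/2 + η`, the amplified circuit accepts
with probability at least `1 - 1/(4 K(|x|) η²)`: the Born weights of the blocks form a product
distribution whose one-block marginal of "answer `1`" is that probability (`sum_filter_blockState_true`),
the threshold stage accepts every label with a strict majority of answers `1` (`perm3_apply_zero`), and
"the majority of `k` independent coin flips each with probability at least `1/2 + η` of heads" fails
with probability `≤ 1/(4kη²)` (`sum_majority_fail_mul_le`). [cite: BennettBernsteinBrassardVazirani1997, Thm. 4.13 (proof)] -/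
theorem acceptProb_circ_ge (x : List Bool) {η : ℝ} (hη : 0 < η) (hx : 1 / 2 + η ≤ oneCleanQubitAcceptProb (P.C x)) :
    1 - 1 / (4 * K P x.length * η ^ 2) ≤ (circ P x).acceptProb 0 (fun _ : Fin 1 => false) := by
  rw [acceptProb_circ_eq]
  have hK := K_pos (P := P) x.length
  have hpos : (0 : ℝ) < 4 * K P x.length * η ^ 2 := by positivity
  -- the weighted Chebyshev bound for the product weights of the blocks
  have hcheb := sum_majority_fail_mul_le (fun v : QReg (b P x.length) => ‖blockState P x v‖ ^ 2)
    (fun v => by positivity) sum_normSq_blockState (fun v : QReg (b P x.length) => v ⟨0, b_pos x.length⟩ = true) hK hη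
    (by rw [sum_filter_blockState_true]; exact hx)
  set w : QReg (b P x.length) → ℝ := fun v => ‖blockState P x v‖ ^ 2 with hw
  set fail : (Fin (K P x.length) → QReg (b P x.length)) → Prop :=
    fun y => 2 * (univ.filter fun j => y j ⟨0, b_pos x.length⟩ = true).card ≤ K P x.length with hfail
  have hfailSum : (∑ y ∈ univ.filter fail, ∏ j, w (y j)) ≤ 1 / (4 * K P x.length * η ^ 2) := by
    rw [le_div_iff₀ hpos]; exact hcheb
  have htot : (∑ y : Fin (K P x.length) → QReg (b P x.length), ∏ j, w (y j)) = 1 := by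
    have e := Finset.prod_univ_sum (fun _ : Fin (K P x.length) => (univ : Finset (QReg (b P x.length)))) (fun _ v => w v)
    simp only [Fintype.piFinset_univ] at e
    rw [← e, sum_normSq_blockState, Finset.prod_const_one]
  have key : ∀ c : ℕ, ¬ 2 * c ≤ K P x.length → T P x.length ≤ c := fun c h => by unfold T; unfold K at h; omega
  have hterm : ∀ z : QReg (1 + anc P x.length),
      ‖prodState (blockEmb P x.length) (fun _ => blockState P x) (fun _ => false) z‖ ^ 2 *
          (1 - if fail (fun j => z ∘ blockEmb P x.length j) then 1 else 0) ≤
        (if perm3 P x.length z ⟨0, width_pos x.length⟩ = true then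
          ‖prodState (blockEmb P x.length) (fun _ => blockState P x) (fun _ => false) z‖ ^ 2 else 0) := by
    intro z
    by_cases hf : fail (fun j => z ∘ blockEmb P x.length j)
    · rw [if_pos hf, sub_self, mul_zero]
      split_ifs <;> positivity
    · rw [if_neg hf, sub_zero, mul_one]
      by_cases hoff : ∀ w, OffBlocks (blockEmb P x.length) w → z w = false
      · rw [if_pos]
        rw [perm3_apply_zero z hoff, decide_eq_true_iff]
        exact key _ hf
      · have hz : prodState (blockEmb P x.length) (fun _ => blockState P x) (fun _ => false) z = 0 := by
          rw [prodState_apply, if_neg hoff, zero_mul]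
        rw [hz]
        simp
  calc 1 - 1 / (4 * K P x.length * η ^ 2)
      ≤ 1 - ∑ y ∈ univ.filter fail, ∏ j, w (y j) := by linarith
    _ = ∑ y : Fin (K P x.length) → QReg (b P x.length), (∏ j, w (y j)) * (1 - if fail y then 1 else 0) := by
        have e : ∀ y : Fin (K P x.length) → QReg (b P x.length), (∏ j, w (y j)) * (1 - if fail y then 1 else 0) =
            (∏ j, w (y j)) - (if fail y then ∏ j, w (y j) else 0) := fun y => by
          split_ifs <;> ring
        simp only [e, Finset.sum_sub_distrib, htot, Finset.sum_filter]
    _ = ∑ z : QReg (1 + anc P x.length),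
          ‖prodState (blockEmb P x.length) (fun _ => blockState P x) (fun _ => false) z‖ ^ 2 *
            (1 - if fail (fun j => z ∘ blockEmb P x.length j) then 1 else 0) :=
        (sum_normSq_prodState_mul blockDisjoint (fun _ => blockState P x) (fun _ => false)
          (fun y => 1 - if fail y then 1 else 0)).symm
    _ ≤ _ := Finset.sum_le_sum fun z _ => hterm z

/-- **No-instances.** If the one-clean-qubit acceptance probability of `C x` is at most `1/2 - η`,
the amplified circuit accepts with probability at most `1/(4 K(|x|) η²)`: accepting requires at least
`T = K' + 1` answers `1`, hence at most `K'` answers `0`, i.e. no strict majority of the (likely)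
answer `0`. [cite: BennettBernsteinBrassardVazirani1997, Thm. 4.13 (proof)] -/
theorem acceptProb_circ_le (x : List Bool) {η : ℝ} (hη : 0 < η) (hx : oneCleanQubitAcceptProb (P.C x) ≤ 1 / 2 - η) :
    (circ P x).acceptProb 0 (fun _ : Fin 1 => false) ≤ 1 / (4 * K P x.length * η ^ 2) := by
  rw [acceptProb_circ_eq]
  have hK := K_pos (P := P) x.length
  have hpos : (0 : ℝ) < 4 * K P x.length * η ^ 2 := by positivity
  have hcheb := sum_majority_fail_mul_le (fun v : QReg (b P x.length) => ‖blockState P x v‖ ^ 2)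
    (fun v => by positivity) sum_normSq_blockState (fun v : QReg (b P x.length) => v ⟨0, b_pos x.length⟩ = false) hK hη
    (by rw [sum_filter_blockState_false]; linarith)
  set w : QReg (b P x.length) → ℝ := fun v => ‖blockState P x v‖ ^ 2 with hw
  set fail : (Fin (K P x.length) → QReg (b P x.length)) → Prop :=
    fun y => 2 * (univ.filter fun j => y j ⟨0, b_pos x.length⟩ = false).card ≤ K P x.length with hfail
  have hfailSum : (∑ y ∈ univ.filter fail, ∏ j, w (y j)) ≤ 1 / (4 * K P x.length * η ^ 2) := by
    rw [le_div_iff₀ hpos]; exact hcheb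
  have key : ∀ ct cf : ℕ, ct + cf = K P x.length → T P x.length ≤ ct → 2 * cf ≤ K P x.length := fun ct cf h1 h2 => by
    unfold T at h2; unfold K at h1 ⊢; omega
  have hterm : ∀ z : QReg (1 + anc P x.length),
      (if perm3 P x.length z ⟨0, width_pos x.length⟩ = true then
          ‖prodState (blockEmb P x.length) (fun _ => blockState P x) (fun _ => false) z‖ ^ 2 else 0) ≤
        ‖prodState (blockEmb P x.length) (fun _ => blockState P x) (fun _ => false) z‖ ^ 2 *
          (if fail (fun j => z ∘ blockEmb P x.length j) then 1 else 0) := by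
    intro z
    by_cases hacc : perm3 P x.length z ⟨0, width_pos x.length⟩ = true
    · rw [if_pos hacc]
      by_cases hoff : ∀ w, OffBlocks (blockEmb P x.length) w → z w = false
      · rw [perm3_apply_zero z hoff, decide_eq_true_iff] at hacc
        have hf : fail (fun j => z ∘ blockEmb P x.length j) :=
          key _ _ (card_true_add_card_false (P := P) (n := x.length) (fun j => z (ansW x.length j))) hacc
        rw [if_pos hf, mul_one]
      · have hz : prodState (blockEmb P x.length) (fun _ => blockState P x) (fun _ => false) z = 0 := by
          rw [prodState_apply, if_neg hoff, zero_mul]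
        rw [hz]
        simp
    · rw [if_neg hacc]
      positivity
  calc (∑ z : QReg (1 + anc P x.length), if perm3 P x.length z ⟨0, width_pos x.length⟩ = true then
          ‖prodState (blockEmb P x.length) (fun _ => blockState P x) (fun _ => false) z‖ ^ 2 else 0)
      ≤ ∑ z : QReg (1 + anc P x.length), ‖prodState (blockEmb P x.length) (fun _ => blockState P x) (fun _ => false) z‖ ^ 2 *
          (if fail (fun j => z ∘ blockEmb P x.length j) then 1 else 0) := Finset.sum_le_sum fun z _ => hterm z
    _ = ∑ y : Fin (K P x.length) → QReg (b P x.length), (∏ j, w (y j)) * (if fail y then 1 else 0) :=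
        sum_normSq_prodState_mul blockDisjoint (fun _ => blockState P x) (fun _ => false) (fun y => if fail y then 1 else 0)
    _ = ∑ y ∈ univ.filter fail, ∏ j, w (y j) := by
        rw [Finset.sum_filter]
        exact Finset.sum_congr rfl fun y _ => by split_ifs <;> simp
    _ ≤ _ := hfailSum

end Law

/-! ## Part V. The description of the amplified circuit is polynomial-time computable

The record `⟨[0], ⟨bin 1, ⟨1^{anc |x|}, encode (circ x)⟩⟩⟩` (the instance format of the circuit
acceptance reduction, `Lemma24InstanceFP.inRec`) is an `FP` function of `x`, provided the descriptions
`x ↦ sigmaEncode ⟨1, k x, C x⟩` of the one-clean-qubit circuits are (the hypothesis of `IsDQC1Decidable`).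
`encode (circ x)` is the concatenation of the description bits of the quantum stage — for every
`j < K(|x|)`, "swap (`SwapDesc.swapDescFn` at the binary offset `base + j·b`), Hadamard and `CNOT`
layer of the purification (a generator program run on the unary register size `1^{k x}` read off the
given description), the given code verbatim, swap", folded over `j` by the counted concatenation fold
of `FoldBricks.lean` (the pattern of `PolyCopies.sqF`) — and of the threshold stage (a generator program
with nested counted loops over the grid, `GenPrograms.lean`), behind the header (Arora–Barak 2009, §6.2
and Remark 6.7: descriptions printed with counters). -/

section Uniform

open Polynomial Complexity.Brick Plumb RevClean Complexity.GExpr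

/-! ### Stage descriptions are program descriptions -/

section Desc

variable {P}

/-- The description bits of a clamped compiled program are the `opBits` of the program. [cite: AroraBarak2009, §6.1] -/
theorem flatMap_gateEnc_clamp (n : ℕ) (ops : List (ClOp ℕ)) (hlt : ∀ op ∈ ops, ∀ i ∈ wiresOf op, i < 1 + anc P n)
    (hwf : ∀ op ∈ ops, op.WF) :
    (revCompile (clamp P n ops hlt hwf)).flatMap gateEnc = ops.flatMap opBits :=
  flatMap_gateEnc_revCompile_toRevList (width_pos n) ops hlt _

/-- The threshold stage describes as `prog3`. [folklore] -/
theorem flatMap_gateEnc_stage3 (n : ℕ) : (stage3 P n).flatMap gateEnc = (prog3 P n).flatMap opBits :=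
  flatMap_gateEnc_clamp n _ _ _

/-- The conjugating swap describes as `progConj` (for `j < K n`). [folklore] -/
theorem flatMap_gateEnc_conjGates {n j : ℕ} (hj : j < K P n) :
    (conjGates P n j).flatMap gateEnc = (progConj P n j).flatMap opBits := by
  unfold conjGates; rw [dif_pos hj]; exact flatMap_gateEnc_clamp n _ _ _

/-- **The copy describes as the purified block**: Hadamard bits, `CNOT` bits, then the given circuit,
verbatim. [cite: AroraBarak2009, §6.2 (a circuit for each input, hard-wired)] -/
theorem flatMap_gateEnc_copyGates (x : List Bool) :
    (copyGates P x).flatMap gateEnc = hBits (P.k x) ++ ((cnotProg (P.k x)).flatMap opBits ++ (P.C x).encode) := by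
  rw [← flatMap_gateEnc_purify]
  unfold copyGates Cblk frontEmb
  simp only [gates_mapWires, List.map_map, List.flatMap_map, Function.comp_apply, CWrap.gateEnc_mapWiresGate_castLEEmb]

/-- The unary numeral of `k` has length `k`. [folklore] -/
theorem length_unaryEncodeNat' (k : ℕ) : (unaryEncodeNat k).length = k := by
  rw [RevDesc.unaryEncodeNat_eq_replicate, List.length_replicate]

end Desc

/-! ### The layout as counter expressions and as polynomials -/

/-- The register bound `p` as an expression in the input length `uu`. [folklore] -/
def pE : GE := CWrap.polyE P.pd (.var .uu)

/-- The block width `b` as an expression. [folklore] -/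
def bE : GE := .add (.mul (.const 2) (pE P)) (.const 2)

/-- `K'` as an expression. [folklore] -/
def K'E : GE := CWrap.polyE P.pK (.var .uu)

/-- The number of copies `K` as an expression. [folklore] -/
def KE : GE := .add (.mul (.const 2) (K'E P)) (.const 1)

/-- The threshold `T` as an expression. [folklore] -/
def TE : GE := .add (K'E P) (.const 1)

/-- The first block wire `base` as an expression. [folklore] -/
def baseE : GE := .add (bE P) (.const 1)

/-- Wire `i` of block `j` as an expression transformer. [folklore] -/
def blkE (jE iE : GE) : GE := .add (.add (baseE P) (.mul jE (bE P))) iE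

/-- `G0` as an expression. [folklore] -/
def G0E : GE := .add (baseE P) (.mul (KE P) (bE P))

/-- The cell `cpos t j` as an expression transformer. [folklore] -/
def cposE (tE jE : GE) : GE := .add (.add (G0E P) (.mul tE (.add (KE P) (.const 1)))) jE

/-- `D0` as an expression. [folklore] -/
def D0E : GE := .add (G0E P) (.mul (.add (TE P) (.const 1)) (.add (KE P) (.const 1)))

/-- The conjunction ancilla `dpos t j` as an expression transformer. [folklore] -/
def dposE (tE jE : GE) : GE := .add (.add (D0E P) (.mul tE (KE P))) jE

/-- `b(n)` as a polynomial. [folklore] -/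
def bPoly : Polynomial ℕ := C 2 * P.pd + C 2

/-- `K(n)` as a polynomial. [folklore] -/
def KPoly : Polynomial ℕ := C 2 * P.pK + C 1

/-- `T(n)` as a polynomial. [folklore] -/
def TPoly : Polynomial ℕ := P.pK + C 1

/-- `base(n)` as a polynomial. [folklore] -/
def basePoly : Polynomial ℕ := bPoly P + C 1

/-- `G0(n)` as a polynomial. [folklore] -/
def G0Poly : Polynomial ℕ := basePoly P + KPoly P * bPoly P

/-- `D0(n)` as a polynomial. [folklore] -/
def D0Poly : Polynomial ℕ := G0Poly P + (TPoly P + C 1) * (KPoly P + C 1)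

/-- `anc(n) = W(n) - 1` as a polynomial. [folklore] -/
def ancPoly : Polynomial ℕ := D0Poly P + (TPoly P + C 1) * KPoly P

variable {P}

/-- Value of `pE`. [folklore] -/
@[simp] theorem eval_pE (env : GV → ℕ) : (pE P).eval env = p P (env .uu) := by simp [pE, GExpr.eval, p]

/-- Value of `bE`. [folklore] -/
@[simp] theorem eval_bE (env : GV → ℕ) : (bE P).eval env = b P (env .uu) := by simp [bE, GExpr.eval, b]

/-- Value of `K'E`. [folklore] -/
@[simp] theorem eval_K'E (env : GV → ℕ) : (K'E P).eval env = K' P (env .uu) := by simp [K'E, GExpr.eval, K']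

/-- Value of `KE`. [folklore] -/
@[simp] theorem eval_KE (env : GV → ℕ) : (KE P).eval env = K P (env .uu) := by simp [KE, GExpr.eval, K]

/-- Value of `TE`. [folklore] -/
@[simp] theorem eval_TE (env : GV → ℕ) : (TE P).eval env = T P (env .uu) := by simp [TE, GExpr.eval, T]

/-- Value of `baseE`. [folklore] -/
@[simp] theorem eval_baseE (env : GV → ℕ) : (baseE P).eval env = base P (env .uu) := by simp [baseE, GExpr.eval, base]

/-- Value of `blkE`. [folklore] -/
@[simp] theorem eval_blkE (jE iE : GE) (env : GV → ℕ) : (blkE P jE iE).eval env = blk P (env .uu) (jE.eval env) (iE.eval env) := by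
  simp [blkE, GExpr.eval, blk]

/-- Value of `G0E`. [folklore] -/
@[simp] theorem eval_G0E (env : GV → ℕ) : (G0E P).eval env = G0 P (env .uu) := by simp [G0E, GExpr.eval, G0]

/-- Value of `cposE`. [folklore] -/
@[simp] theorem eval_cposE (tE jE : GE) (env : GV → ℕ) :
    (cposE P tE jE).eval env = cpos P (env .uu) (tE.eval env) (jE.eval env) := by
  simp [cposE, GExpr.eval, cpos]

/-- Value of `D0E`. [folklore] -/
@[simp] theorem eval_D0E (env : GV → ℕ) : (D0E P).eval env = D0 P (env .uu) := by simp [D0E, GExpr.eval, D0]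

/-- Value of `dposE`. [folklore] -/
@[simp] theorem eval_dposE (tE jE : GE) (env : GV → ℕ) :
    (dposE P tE jE).eval env = dpos P (env .uu) (tE.eval env) (jE.eval env) := by
  simp [dposE, GExpr.eval, dpos]

/-- Value of `bPoly`. [folklore] -/
@[simp] theorem eval_bPoly (n : ℕ) : (bPoly P).eval n = b P n := by simp [bPoly, b, p]

/-- Value of `KPoly`. [folklore] -/
@[simp] theorem eval_KPoly (n : ℕ) : (KPoly P).eval n = K P n := by simp [KPoly, K, K']

/-- Value of `TPoly`. [folklore] -/
@[simp] theorem eval_TPoly (n : ℕ) : (TPoly P).eval n = T P n := by simp [TPoly, T, K']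

/-- Value of `basePoly`. [folklore] -/
@[simp] theorem eval_basePoly (n : ℕ) : (basePoly P).eval n = base P n := by simp [basePoly, base]

/-- Value of `G0Poly`. [folklore] -/
@[simp] theorem eval_G0Poly (n : ℕ) : (G0Poly P).eval n = G0 P n := by simp [G0Poly, G0]

/-- Value of `D0Poly`. [folklore] -/
@[simp] theorem eval_D0Poly (n : ℕ) : (D0Poly P).eval n = D0 P n := by simp [D0Poly, D0]

/-- Value of `ancPoly`. [folklore] -/
@[simp] theorem eval_ancPoly (n : ℕ) : (ancPoly P).eval n = anc P n := by simp [ancPoly, anc, W]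

/-! ### The threshold stage: a generator with nested loops over the grid -/

variable (P)

/-- The cell of row `tt + 1`, column `jj`, as generator expressions. [folklore] -/
def cellE : List (ClOp GE) :=
  [ClOp.toffoli (blkE P (.var .jj) (.const 0)) (cposE P (.var .tt) (.var .jj)) (dposE P (.add (.var .tt) (.const 1)) (.var .jj)),
   ClOp.cnot (cposE P (.add (.var .tt) (.const 1)) (.var .jj)) (cposE P (.add (.var .tt) (.const 1)) (.add (.var .jj) (.const 1))),
   ClOp.cnot (dposE P (.add (.var .tt) (.const 1)) (.var .jj)) (cposE P (.add (.var .tt) (.const 1)) (.add (.var .jj) (.const 1))),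
   ClOp.toffoli (cposE P (.add (.var .tt) (.const 1)) (.var .jj)) (dposE P (.add (.var .tt) (.const 1)) (.var .jj))
     (cposE P (.add (.var .tt) (.const 1)) (.add (.var .jj) (.const 1)))]

/-- **Generator of the threshold stage**: `for j ≤ K: NOT (cpos 0 j)`; `for j < K, for t < T: cell t j`;
`CNOT (cpos T K) 0`. [cite: AroraBarak2009, §6.2 (descriptions printed with counters)] -/
def gen3 : GS :=
  .seq (.loop .jj (.add (KE P) (.const 1)) (opsG [ClOp.not (cposE P (.const 0) (.var .jj))]))
    (.seq (.loop .jj (KE P) (.loop .tt (TE P) (opsG (cellE P))))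
      (opsG [ClOp.cnot (cposE P (TE P) (KE P)) (.const 0)]))

variable {P}

/-- **The threshold generator prints `prog3`.** [folklore] -/
theorem out_gen3 (env : GV → ℕ) : (gen3 P).out env = (prog3 P (env .uu)).flatMap opToks := by
  have huj : ∀ k, Function.update env GV.jj k GV.uu = env GV.uu := fun k => Function.update_of_ne (by decide) _ _
  have hjj : ∀ k, Function.update env GV.jj k GV.jj = k := fun k => Function.update_self _ _ _
  have hut : ∀ k k', Function.update (Function.update env GV.jj k) GV.tt k' GV.uu = env GV.uu := fun k k' => by
    rw [Function.update_of_ne (by decide), Function.update_of_ne (by decide)]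
  have hutj : ∀ k k', Function.update (Function.update env GV.jj k) GV.tt k' GV.jj = k := fun k k' => by
    rw [Function.update_of_ne (by decide), Function.update_self]
  have hutt : ∀ k k', Function.update (Function.update env GV.jj k) GV.tt k' GV.tt = k' := fun k k' => Function.update_self _ _ _
  simp only [gen3, cellE, GStmt.out, out_opsG, List.map_cons, List.map_nil, ClOp.map, GExpr.eval, huj, hjj, hut, hutj, hutt,
    eval_cposE, eval_dposE, eval_blkE, eval_KE, eval_TE, List.flatMap_cons, List.flatMap_nil, List.append_nil, prog3, progRow0,
    progCells, colOps, cellOps, progOut, List.flatMap_append, List.flatMap_assoc, List.flatMap_map]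

/-- `uu` is not a loop variable of the threshold generator. [folklore] -/
theorem uu_notMem_loopVars_gen3 : GV.uu ∉ (gen3 P).loopVars := by
  intro h
  simp only [gen3, GStmt.loopVars, List.mem_cons, List.mem_append] at h
  rcases h with (h | h) | ((h | h | h) | h)
  · exact absurd h (by decide)
  · exact absurd (loopVars_opsG_sub _ _ h) (by decide)
  · exact absurd h (by decide)
  · exact absurd h (by decide)
  · exact absurd (loopVars_opsG_sub _ _ h) (by decide)
  · exact absurd (loopVars_opsG_sub _ _ h) (by decide)

/-- Non-reuse of the threshold generator. [folklore] -/
theorem noReuse_gen3 : (gen3 P).noReuse = true :=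
  noReuse_seq_of (noReuse_loop_of (lv_opsG (by decide) _) (noReuse_opsG _))
    (noReuse_seq_of (noReuse_loop_of (lv_loop (P := (· ≠ GV.jj)) (by decide) (lv_opsG (by decide) _))
      (noReuse_loop_of (lv_opsG (by decide) _) (noReuse_opsG _))) (noReuse_opsG _))

/-- **The threshold stage describes in polynomial time.** [cite: AroraBarak2009, §6.2 Def. 6.12 and Remark 6.7] -/
theorem stage3_desc_mem_FP : (fun z : List Bool => (stage3 P z.length).flatMap gateEnc) ∈ FP := by
  have h := GStmt.render_out_mem_FP (gen3 P) GV.uu uu_notMem_loopVars_gen3 noReuse_gen3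
  refine (congrArg (· ∈ FP) (funext fun z => ?_)).mpr h
  rw [out_gen3, RevClean.render_flatMap_opToks_nil, GenProg.initEnv_self, flatMap_gateEnc_stage3]

/-! ### The purification layer: a generator run on the unary register size -/

/-- **Generator of the purification layer** in the register size `uu = k`: `for i < k: H (1 + k + i)`;
`for i < k: CNOT (1 + k + i) (1 + i)`. [cite: AroraBarak2009, §6.2 (descriptions printed with counters)] -/
def genPur : GS :=
  .seq (.loop .jj (.var .uu) (agateG ⟨.H, [.add (.add (.const 1) (.var .uu)) (.var .jj)]⟩))
    (.loop .jj (.var .uu) (opsG [ClOp.cnot (.add (.add (.const 1) (.var .uu)) (.var .jj)) (.add (.const 1) (.var .jj))]))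

/-- **The purification generator prints the Hadamard tokens and the `CNOT` tokens.** [folklore] -/
theorem out_genPur (env : GV → ℕ) :
    genPur.out env = ((List.range (env .uu)).map fun i => (⟨.H, [1 + env .uu + i]⟩ : AGate ℕ)).flatMap AGate.toks ++
      (cnotProg (env .uu)).flatMap opToks := by
  have huj : ∀ k, Function.update env GV.jj k GV.uu = env GV.uu := fun k => Function.update_of_ne (by decide) _ _
  have hjj : ∀ k, Function.update env GV.jj k GV.jj = k := fun k => Function.update_self _ _ _
  simp only [genPur, GStmt.out, out_agateG, out_opsG, AGate.map, List.map_cons, List.map_nil, ClOp.map, GExpr.eval, huj, hjj,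
    List.flatMap_cons, List.flatMap_nil, List.append_nil, cnotProg, List.flatMap_map]

/-- The loop variables of `agateG` are tick counters. [folklore] -/
theorem loopVars_agateG_sub (g : AGate GE) : ∀ x ∈ (agateG g).loopVars, x = GV.ii := by
  intro x hx
  simp only [agateG, GStmt.loopVars, List.nil_append, List.append_nil, loopVars_seqs, List.mem_flatMap, List.mem_map] at hx
  obtain ⟨s, ⟨w, -, rfl⟩, hs⟩ := hx
  rw [loopVars_wireG, List.mem_singleton] at hs
  exact hs

/-- `agateG` does not reuse loop variables. [folklore] -/
theorem noReuse_agateG (g : AGate GE) : (agateG g).noReuse = true := by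
  simp only [agateG, GStmt.noReuse, Bool.true_and, Bool.and_true]
  refine noReuse_seqs _ fun s hs => ?_
  obtain ⟨w, -, rfl⟩ := List.mem_map.1 hs
  rfl

/-- `uu` is not a loop variable of the purification generator. [folklore] -/
theorem uu_notMem_loopVars_genPur : GV.uu ∉ genPur.loopVars := by
  intro h
  simp only [genPur, GStmt.loopVars, List.mem_cons, List.mem_append] at h
  rcases h with (h | h) | (h | h)
  · exact absurd h (by decide)
  · exact absurd (loopVars_agateG_sub _ _ h) (by decide)
  · exact absurd h (by decide)
  · exact absurd (loopVars_opsG_sub _ _ h) (by decide)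

/-- Non-reuse of the purification generator. [folklore] -/
theorem noReuse_genPur : genPur.noReuse = true :=
  noReuse_seq_of (noReuse_loop_of (fun x hx => by rw [loopVars_agateG_sub _ x hx]; decide) (noReuse_agateG _))
    (noReuse_loop_of (lv_opsG (by decide) _) (noReuse_opsG _))

/-- **The purification layer describes in polynomial time** in the unary register size: on an input
of length `k`, the bits `hBits k ++ (cnotProg k).flatMap opBits`. [cite: AroraBarak2009, §6.2 Def. 6.12 and Remark 6.7] -/
theorem purLayer_desc_mem_FP : (fun z : List Bool => hBits z.length ++ (cnotProg z.length).flatMap opBits) ∈ FP := by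
  have h := GStmt.render_out_mem_FP genPur GV.uu uu_notMem_loopVars_genPur noReuse_genPur
  refine (congrArg (· ∈ FP) (funext fun z => ?_)).mpr h
  rw [out_genPur, GenProg.initEnv_self, render_flatMap_toks, RevClean.render_flatMap_opToks_nil, hBits, List.flatMap_map]
  rfl

/-! ### The quantum stage: a counted fold of swap–purify–copy–swap pieces -/

section StageQ

variable (P) (descD : List Bool → List Bool)

/-- The context field of the piece: the input `x` (as `⟨⟨x, ruler⟩, 1ʲ⟩ ↦ x`). [folklore] -/
def xOf : List Bool → List Bool := fstF ∘ fstF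

/-- The swap piece: the description of the swap of the front window with block `j`, from
`⟨⟨x, ruler⟩, 1ʲ⟩` (offset `base |x| + j · b |x|` in binary, `1^{b |x|}`). [folklore] -/
def swF : List Bool → List Bool :=
  SwapDesc.swapDescFn ∘ fanoutFn
    (addFn ∘ fanoutFn (lenBinF ∘ polyFn (basePoly P) ∘ xOf)
      (prodFn ∘ fanoutFn (lenBinF ∘ sndF) (lenBinF ∘ polyFn (bPoly P) ∘ xOf)))
    (polyFn (bPoly P) ∘ xOf)

/-- The purification piece: Hadamard and `CNOT` bits, from the unary register size read off the
given description `descD x = ⟨bin 1, ⟨1^{k x}, code⟩⟩`. [folklore] -/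
def purF : List Bool → List Bool :=
  (fun z : List Bool => hBits z.length ++ (cnotProg z.length).flatMap opBits) ∘ fstF ∘ sndF ∘ descD ∘ xOf

/-- The code piece: the given circuit's code, verbatim. [cite: AroraBarak2009, §6.2] -/
def codeF : List Bool → List Bool := sndF ∘ sndF ∘ descD ∘ xOf

/-- The copy piece: purification bits, then the code. [folklore] -/
def copyF : List Bool → List Bool := appF ∘ fanoutFn (purF descD) (codeF descD)

/-- The piece of index `j`: swap, copy, swap. [folklore] -/
def pieceQ : List Bool → List Bool := appF ∘ fanoutFn (swF P) (appF ∘ fanoutFn (copyF descD) (swF P))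

variable {P descD} (hD : ∀ x, descD x = QCircuit.sigmaEncode (G := cliffordT) ⟨1, P.k x, P.C x⟩)

/-- `swF` computes the description of the conjugating swap. [folklore] -/
theorem swF_apply (x r : List Bool) (j : ℕ) :
    swF P (boolPair (boolPair x r) (ones j)) = (progConj P x.length j).flatMap opBits := by
  have h : swF P (boolPair (boolPair x r) (ones j)) =
      SwapDesc.swapDescFn (boolPair (encodeNat (base P x.length + j * b P x.length)) (ones (b P x.length))) := by
    simp [swF, xOf, fanoutFn_apply, ones]
  rw [h, SwapDesc.swapDescFn_apply]
  rfl

include hD in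
/-- `purF` computes the purification bits. [folklore] -/
theorem purF_apply (x r : List Bool) (j : ℕ) :
    purF descD (boolPair (boolPair x r) (ones j)) = hBits (P.k x) ++ (cnotProg (P.k x)).flatMap opBits := by
  simp only [purF, Function.comp_apply, xOf, fstF_boolPair, hD, QCircuit.sigmaEncode, sndF_boolPair,
    length_unaryEncodeNat']

include hD in
/-- `codeF` computes the code of the given circuit. [folklore] -/
theorem codeF_apply (x r : List Bool) (j : ℕ) : codeF descD (boolPair (boolPair x r) (ones j)) = (P.C x).encode := by
  simp only [codeF, Function.comp_apply, xOf, fstF_boolPair, hD, QCircuit.sigmaEncode, sndF_boolPair]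

include hD in
/-- `copyF` computes the description of the copy. [folklore] -/
theorem copyF_apply (x r : List Bool) (j : ℕ) :
    copyF descD (boolPair (boolPair x r) (ones j)) = (copyGates P x).flatMap gateEnc := by
  rw [flatMap_gateEnc_copyGates, copyF, Function.comp_apply, fanoutFn_apply, appF_boolPair, purF_apply hD, codeF_apply hD,
    List.append_assoc]

include hD in
/-- The piece of index `j < K |x|` is the description of swap–copy–swap. [folklore] -/
theorem pieceQ_apply (x r : List Bool) {j : ℕ} (hj : j < K P x.length) :
    pieceQ P descD (boolPair (boolPair x r) (ones j)) =
      (conjGates P x.length j ++ (copyGates P x ++ conjGates P x.length j)).flatMap gateEnc := by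
  rw [List.flatMap_append, List.flatMap_append, flatMap_gateEnc_conjGates hj, ← copyF_apply hD x r j, ← swF_apply x r j]
  simp [pieceQ, fanoutFn_apply]

/-- `swF ∈ FP`. [folklore] -/
theorem swF_mem_FP : swF P ∈ FP := by
  have hz : xOf ∈ FP := comp_mem_FP fstF_mem_FP fstF_mem_FP
  exact comp_mem_FP SwapDesc.swapDescFn_mem_FP (fanoutFn_mem_FP
    (comp_mem_FP addFn_mem_FP (fanoutFn_mem_FP (comp_mem_FP lenBinF_mem_FP (comp_mem_FP (polyFn_mem_FP _) hz))
      (comp_mem_FP prodFn_mem_FP (fanoutFn_mem_FP (comp_mem_FP lenBinF_mem_FP sndF_mem_FP)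
        (comp_mem_FP lenBinF_mem_FP (comp_mem_FP (polyFn_mem_FP _) hz))))))
    (comp_mem_FP (polyFn_mem_FP _) hz))

/-- `copyF ∈ FP` for `descD ∈ FP`. [folklore] -/
theorem copyF_mem_FP (hdesc : descD ∈ FP) : copyF descD ∈ FP := by
  have hz : xOf ∈ FP := comp_mem_FP fstF_mem_FP fstF_mem_FP
  have hdx : descD ∘ xOf ∈ FP := comp_mem_FP hdesc hz
  refine comp_mem_FP appF_mem_FP (fanoutFn_mem_FP ?_ ?_)
  · exact comp_mem_FP purLayer_desc_mem_FP (comp_mem_FP fstF_mem_FP (comp_mem_FP sndF_mem_FP hdx))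
  · exact comp_mem_FP sndF_mem_FP (comp_mem_FP sndF_mem_FP hdx)

/-- `pieceQ ∈ FP` for `descD ∈ FP`. [folklore] -/
theorem pieceQ_mem_FP (hdesc : descD ∈ FP) : pieceQ P descD ∈ FP :=
  comp_mem_FP appF_mem_FP (fanoutFn_mem_FP swF_mem_FP (comp_mem_FP appF_mem_FP (fanoutFn_mem_FP (copyF_mem_FP hdesc) swF_mem_FP)))

variable (P descD) (ps pp pc : Polynomial ℕ)

/-- The ruler polynomial: room for the rounds and for every piece. [folklore] -/
def rulerPoly : Polynomial ℕ :=
  KPoly P + (C 2 * ps.comp (C 2 * (ancPoly P + C 1) + C 2 + bPoly P) + (pp.comp P.pd + pc))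

/-- The initial record of the fold: `⟨⟨x, ruler⟩, ⟨bin (K |x|), ⟨1⁰, []⟩⟩⟩`. [folklore] -/
def initQ : List Bool → List Bool :=
  fanoutFn (fanoutFn (fun z => z) (polyFn (rulerPoly P ps pp pc))) (fanoutFn (lenBinF ∘ polyFn (KPoly P)) (fun _ => boolPair [] []))

/-- **The description of the quantum stage** as a string function: fold the pieces `j < K |x|`.
[cite: AroraBarak2009, §1.3 (bounded loops)] -/
def sqF : List Bool → List Bool := sndPow 2 ∘ foldLoop appF (clipF 1 (pieceQ P descD)) X ∘ initQ P ps pp pc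

variable {P descD ps pp pc}

/-- `sqF ∈ FP`. [folklore] -/
theorem sqF_mem_FP (hdesc : descD ∈ FP) : sqF P descD ps pp pc ∈ FP :=
  comp_mem_FP (sndPow_mem_FP 2) (comp_mem_FP (foldLoop_clipF_mem_FP 1 appF_mem_FP length_appF_le (pieceQ_mem_FP hdesc) X)
    (fanoutFn_mem_FP (fanoutFn_mem_FP (PolyTimeComputable.id _) (polyFn_mem_FP _))
      (fanoutFn_mem_FP (comp_mem_FP lenBinF_mem_FP (polyFn_mem_FP _)) (const_mem_FP _))))

include hD in
/-- **The fold computes the description of the quantum stage**, provided the ruler bounds the pieces: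
`|swapDescFn v| ≤ ps |v|`, the purification bits of register size `k` are at most `pp k` long, and
`|descD u| ≤ pc |u|`. [folklore] -/
theorem sqF_apply (hps : ∀ v, (SwapDesc.swapDescFn v).length ≤ ps.eval v.length)
    (hpp : ∀ k, (hBits k ++ (cnotProg k).flatMap opBits).length ≤ pp.eval k)
    (hpc : ∀ u, (descD u).length ≤ pc.eval u.length) (x : List Bool) :
    sqF P descD ps pp pc x = (stageQ P x).flatMap gateEnc := by
  set n := x.length with hn
  set ctx := boolPair x (ones ((rulerPoly P ps pp pc).eval n)) with hctx
  have hinit : initQ P ps pp pc x = boolPair ctx (boolPair (encodeNat (K P n)) (boolPair (ones 0) [])) := by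
    simp [initQ, fanoutFn_apply, hctx, hn, ones]
  have hrounds : K P n ≤ (X : Polynomial ℕ).eval ctx.length := by
    rw [eval_X, hctx, length_boolPair]
    have : K P n ≤ (rulerPoly P ps pp pc).eval n := by simp [rulerPoly]
    simp [ones]; omega
  -- the pieces are within the ruler
  have hpiece : ∀ j, 0 ≤ j → j < 0 + K P n → (pieceQ P descD (boolPair ctx (ones j))).length ≤ 1 * (ctx.length + 1) := by
    intro j _ hj
    have hjK : j < K P n := by omega
    rw [hctx, pieceQ_apply hD x _ (by rw [← hn]; exact hjK), List.flatMap_append, List.flatMap_append, List.length_append,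
      List.length_append, flatMap_gateEnc_conjGates (by rw [← hn]; exact hjK), flatMap_gateEnc_copyGates, ← hn]
    -- the swap part
    have hsw : ((progConj P n j).flatMap opBits).length ≤ ps.eval (2 * (anc P n + 1) + 2 + b P n) := by
      have e : swF P (boolPair (boolPair x (ones ((rulerPoly P ps pp pc).eval n))) (ones j)) =
          SwapDesc.swapDescFn (boolPair (encodeNat (base P n + j * b P n)) (ones (b P n))) := by
        simp [swF, xOf, fanoutFn_apply, ones, hn]
      rw [← swF_apply x (ones ((rulerPoly P ps pp pc).eval n)) j, e]
      refine (hps _).trans (TM2Iter.eval_mono ps ?_)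
      rw [length_boolPair]
      have hb : (encodeNat (base P n + j * b P n)).length ≤ anc P n + 1 := by
        refine (Complexity.length_encodeNat_le_self _).trans ?_
        have h4 : j * b P n ≤ K P n * b P n := Nat.mul_le_mul_right _ hjK.le
        have := G0_lt_width (P := P) n
        unfold G0 at this; omega
      simp [ones]; omega
    -- the purification part
    have hpu : (hBits (P.k x)).length + ((cnotProg (P.k x)).flatMap opBits).length ≤ pp.eval (P.pd.eval n) := by
      rw [← List.length_append]
      exact (hpp _).trans (TM2Iter.eval_mono pp (by rw [hn]; exact P.hk x))
    -- the code part
    have hcp : (P.C x).encode.length ≤ pc.eval n := by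
      have h := hpc x
      rw [hD, QCircuit.sigmaEncode, length_boolPair, length_boolPair, ← hn] at h
      omega
    have hr : (rulerPoly P ps pp pc).eval n = K P n + (2 * ps.eval (2 * (anc P n + 1) + 2 + b P n) + (pp.eval (P.pd.eval n) + pc.eval n)) := by
      simp [rulerPoly]
    simp only [List.length_append, length_boolPair, ones, List.length_replicate, one_mul]
    omega
  rw [sqF, Function.comp_apply, Function.comp_apply, hinit, foldLoop_apply appF (clipF 1 (pieceQ P descD)) hrounds 0 [],
    sndPow_succ_boolPair, sndPow_succ_boolPair, sndPow_zero_boolPair, foldAcc_clipF hpiece, foldAcc_appF, List.nil_append,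
    stageQ, List.flatMap_assoc, CWrap.flatMap_range_eq_ccat]
  refine ccat_congr fun j hj => ?_
  rw [Nat.zero_add, hctx, pieceQ_apply hD x _ (by rw [← hn]; omega)]

end StageQ

/-! ### The header and the assembly -/

/-- **The record of the amplified circuit is polynomial-time computable**: if the descriptions
`x ↦ sigmaEncode ⟨1, k x, C x⟩` of the one-clean-qubit circuits are in `FP`, then so is
`x ↦ ⟨[0], ⟨bin 1, ⟨1^{anc |x|}, encode (circ x)⟩⟩⟩`. [cite: AroraBarak2009, §6.2 Def. 6.12 and Remark 6.7 (descriptions printed in polynomial time)] -/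
theorem desc_mem_FP (hdesc : (fun x => QCircuit.sigmaEncode (G := cliffordT) ⟨1, P.k x, P.C x⟩) ∈ FP) :
    (fun x => boolPair [false] (boolPair (encodeNat 1) (boolPair (unaryEncodeNat (anc P x.length)) (circ P x).encode))) ∈ FP := by
  set descD : List Bool → List Bool := fun x => QCircuit.sigmaEncode (G := cliffordT) ⟨1, P.k x, P.C x⟩ with hdescD
  have hD : ∀ x, descD x = QCircuit.sigmaEncode (G := cliffordT) ⟨1, P.k x, P.C x⟩ := fun x => rfl
  obtain ⟨ps, hps⟩ := exists_poly_length_le_of_mem_FP SwapDesc.swapDescFn_mem_FP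
  obtain ⟨pp, hpp⟩ := exists_poly_length_le_of_mem_FP purLayer_desc_mem_FP
  obtain ⟨pc, hpc⟩ := exists_poly_length_le_of_mem_FP hdesc
  have hpp' : ∀ k, (hBits k ++ (cnotProg k).flatMap opBits).length ≤ pp.eval k := fun k => by
    have h := hpp (unaryEncodeNat k)
    rwa [length_unaryEncodeNat'] at h
  have h := fanoutFn_mem_FP (const_mem_FP [false]) (fanoutFn_mem_FP (const_mem_FP (encodeNat 1))
    (fanoutFn_mem_FP (polyFn_mem_FP (ancPoly P)) (append_mem_FP (sqF_mem_FP (P := P) (ps := ps) (pp := pp) (pc := pc) hdesc)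
      (stage3_desc_mem_FP (P := P)))))
  refine (congrArg (· ∈ FP) (funext fun x => ?_)).mpr h
  have henc : (circ P x).encode = (stageQ P x ++ stage3 P x.length).flatMap gateEnc := by
    unfold circ; exact encode_eq_flatMap _
  rw [fanoutFn_apply, fanoutFn_apply, fanoutFn_apply, polyFn_apply, eval_ancPoly, sqF_apply hD hps hpp' hpc, henc,
    List.flatMap_append]
  simp only [ones, RevDesc.unaryEncodeNat_eq_replicate]

end Uniform

end DQC1Amp

end Literature.Computability.QuantumComplexity

end
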